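import Literature.NumberTheory.Sieve.JurkatRichertLinearSieveLower
import Literature.NumberTheory.Sieve.ChenTwin
import Literature.NumberTheory.LFunctions.MertensConstant
import Literature.NumberTheory.Sieve.LevelOfDistributionProofs
import Literature.NumberTheory.Sieve.ParityWave0Proofs
import HarnessLib

/-!
# Chen's theorem, twin form: the sieve estimate (A) from Jurkat–Richert and Bombieri–Vinogradov

Trunk T-SIEVE, family `parity` (parity.S12, `Literature.NumberTheory.Sieve.chen_twin`). This file PROVES the DAG node
(A) `Literature.NumberTheory.Sieve.Chen.twin_sieveLower` of `Literature.NumberTheory.Sieve.ChenTwin` — the twin-form analogue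
of Nathanson, *Additive Number Theory: The Classical Bases* (GTM 164), Theorem 10.4:
for every `ε > 0` and all large `x`,

  `S(𝒜(x), x^{1/8}) ≥ (e^γ log 3 / 2 − ε) · (x / log x) · V(x^{1/8})`,

`𝒜(x) = {p + 2 : 2 < p ≤ x}`, `V(w) = ∏_{2<p<w} (1 − 1/(p−1))` — from the two deep inputs of
Nathanson's proof, taken as hypotheses (named facts of the tree, both since PROVED):

* `Literature.NumberTheory.Sieve.LinearSieve.jurkatRichert_lower_allLevels` — the Jurkat–Richert
  lower bound for the linear sieve in Nathanson's explicit form (Thm 9.7 (9.36) with Thm 9.8: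
  `f(s) = 2e^γ log(s−1)/s`, `2 ≤ s ≤ 4`), with hypothesis (9.34) at every sieving level `w ≤ z`
  (`SieveSequence.HasMertensHypothesisBelow`) — the corrected, PROVED form
  (`LinearSieve.jurkatRichert_lower_allLevels_holds`, `JurkatRichertLinearSieveLower.lean`) of the
  single-level transcription `LinearSieve.jurkatRichert_lower`, which is deprecated since 2026-08-15
  (mis-stated relative to the source's proof; see `JurkatRichertLinearSieve.lean`);
* `Literature.NumberTheory.Sieve.BombieriVinogradovStatement` — the Bombieri–Vinogradov theorem
  (level `x^θ`, all `θ < 1/2`), through its PROVED `π`-form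
  `Literature.NumberTheory.Sieve.BombieriVinogradovStatement.primesHaveLevelPi`;

and from results PROVED in the tree: the prime number theorem
(`Literature.NumberTheory.Sieve.tendsto_primeCounting_mul_log_div`), Mertens' theorem with its constant
(`Literature.NumberTheory.LFunctions.Mertens.tendsto_log_mul_prod_one_sub_inv_nat`, giving hypothesis (9.34) of Thm 9.7 for
`g(p) = 1/(p−1)` at all levels: `exists_prod_one_sub_inv_totient_inv_le`), and the crude bound
`V(w) ≥ 2e^{−7}/log w` (`Literature.Chen.oddDensityProd_ge`).

Main results: `Chen.twin_sieveLower_of_allLevels : jurkatRichert_lower_allLevels →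
BombieriVinogradovStatement → twin_sieveLower` and, feeding it the tree's proof of the sieve input,
`Chen.twin_sieveLower_of_bombieriVinogradov : BombieriVinogradovStatement → twin_sieveLower`
(Nathanson's own route to (A); the unconditional `Chen.twin_sieveLower_holds` of
`ChenTwinSieveLowerHolds.lean` goes through Iwaniec's Theorem 1 instead). The original
`Chen.twin_sieveLower_of : jurkatRichert_lower → BombieriVinogradovStatement → twin_sieveLower`
(hypothesis: the deprecated single-level fact) is kept, deprecated, as a two-line corollary of
`twin_sieveLower_of_allLevels` (2026-08-15).

## The proof (Nathanson §10.4, pp. 171–172 of the held copy, with `N − p ↦ p + 2`)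

Apply Thm 9.7 to the sifted sequence `twinSeq x` (weights `a(n) = 1_{𝒜(x)}(n)`, height `x + 2`,
density `g(d) = 1/φ(d)` on odd `d` = `Literature.shiftedPrimesDensity 2`, size `π(x) − 1 = |A|`), sifting
primes `P = ∏_{2<p<z} p` (`oddPrimesProd z`), exceptional set `𝒬 = {p ∣ P : p < u₀(ε)}`,
`z = x^{1/8}`, `D = x^{1/2 − δ}`; then `s = log D/log z = 4 − 8δ ∈ [3, 4]` and
`f(s) = 2e^γ log(3 − 8δ)/(4 − 8δ) ≥ e^γ log 3/2 − O(δ)` (`sieveLowerConst_ge`). Here `S(A, P; x+2)` is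
the number of `p + 2`, `2 < p ≤ x`, without prime factor `< z` (`sifted_twinSeq_eq`),
`V(P) = Literature.Chen.sieveProduct 2 z` (`densityProduct_twinSeq_eq`), and for odd squarefree `d ≥ 3`,
`|A_d| = π(x; d, −2)` (`congrSum_twinSeq_eq`), so `|r(d)| ≤ |π(x; d, −2) − π(x)/φ(d)| + 1`; hence
`R = ∑_{d ∣ P, d < DQ} |r(d)| ≤ ∑_{d ≤ x^{1/2−δ/2}} max_a |π(x; d, a) − π(x)/φ(d)| + x^{1/2} ≪ x/(log x)⁴`
by Bombieri–Vinogradov (`eventually_sum_abs_primeCountingDisc_le`), which is `o((x/log x) V)` as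
`V ≫ 1/log x`. Hypothesis (9.34) holds for all `1 < u < w ≤ z` by Mertens
(`hasMertensHypothesisBelow_twinSeq`; the top-level instance is `hasMertensHypothesis_twinSeq`),
(9.33) since `g(p) = 1/(p−1) ∈ [0, 1)` for odd `p`. Finally
`|A| = π(x) − 1 = (1 + o(1)) x/log x` (PNT).

## References

* M. B. Nathanson, *Additive Number Theory: The Classical Bases*, GTM 164 (1996), Thm 10.4 and its
  proof (PDF pp. 171–172), §10.3 (verification of (9.33)–(9.34), pp. 169–170). [Nathanson1996]
* Chen Jing-run, Sci. Sinica 16 (1973), p. 176 (= W p. 168): the twin form "by the same method".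
  [ChenSciSinica1973]
* H. Iwaniec, E. Kowalski, *Analytic Number Theory*, Thm 17.1 (Bombieri–Vinogradov). [IwaniecKowalski2004]
* H. L. Montgomery, R. C. Vaughan, *Multiplicative Number Theory I*, §8.1 (PNT). [MontgomeryVaughan2007]
-/

open Finset Filter Topology

noncomputable section

namespace Literature.NumberTheory.Sieve.Chen

open LinearSieve ChenSieve SieveSequence


/-! ### Mertens: the linear-sieve hypothesis (9.34) for `g(p) = 1/(p-1)` -/

/-- Splitting the primes below `z` at `u ≤ z`: `{p < z} = {p < u} ⊔ {u ≤ p < z}`. [folklore] -/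
theorem primesBelow_ceil_filter_lt {u z : ℝ} (huz : u ≤ z) :
    (Nat.primesBelow ⌈z⌉₊).filter (fun p : ℕ => ¬ u ≤ (p : ℝ)) = Nat.primesBelow ⌈u⌉₊ := by
  ext p
  simp only [Finset.mem_filter, Nat.primesBelow, Finset.mem_range, not_le, Nat.lt_ceil]
  constructor
  · rintro ⟨⟨-, hp⟩, hu⟩; exact ⟨hu, hp⟩
  · rintro ⟨hu, hp⟩; exact ⟨⟨lt_of_lt_of_le hu huz, hp⟩, hu⟩

/-- `∏_{p < z} f(p) = ∏_{p < u} f(p) · ∏_{u ≤ p < z} f(p)` for `u ≤ z`. [folklore] -/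
theorem prod_primesBelow_split {u z : ℝ} (huz : u ≤ z) (f : ℕ → ℝ) :
    ∏ p ∈ Nat.primesBelow ⌈z⌉₊, f p =
      (∏ p ∈ Nat.primesBelow ⌈u⌉₊, f p) *
        ∏ p ∈ (Nat.primesBelow ⌈z⌉₊).filter (fun p : ℕ => u ≤ (p : ℝ)), f p := by
  rw [← Finset.prod_filter_mul_prod_filter_not (Nat.primesBelow ⌈z⌉₊) (fun p : ℕ => u ≤ (p : ℝ)),
    primesBelow_ceil_filter_lt huz, mul_comm]

/-- `primesBelow ⌈t⌉₊ = primesLE (⌈t⌉₊ - 1)`: the primes `< t` are the primes `≤ ⌈t⌉ - 1`. [folklore] -/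
theorem primesBelow_ceil_eq_primesLE (t : ℝ) : Nat.primesBelow ⌈t⌉₊ = Nat.primesLE (⌈t⌉₊ - 1) :=
  Nat.primesBelow_eq_primesLE_sub_one _

/-- `∏_{u ≤ p < z} (1 + 1/(p(p-2))) ≤ exp(2/(u - 2))` for `u ≥ 3`. [folklore] -/
theorem prod_one_add_inv_mul_sub_two_le {u z : ℝ} (hu : 3 ≤ u) :
    ∏ p ∈ (Nat.primesBelow ⌈z⌉₊).filter (fun p : ℕ => u ≤ (p : ℝ)), (1 + 1 / ((p : ℝ) * ((p : ℝ) - 2))) ≤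
      Real.exp (2 / (u - 2)) := by
  set S := (Nat.primesBelow ⌈z⌉₊).filter (fun p : ℕ => u ≤ (p : ℝ)) with hS
  have hmem : ∀ p ∈ S, p.Prime ∧ u ≤ (p : ℝ) := fun p hp => by
    rw [hS, Finset.mem_filter, Nat.primesBelow, Finset.mem_filter] at hp
    exact ⟨hp.1.2, hp.2⟩
  -- each factor is `≤ exp(1/(p(p-2)))`, and `1/(p(p-2)) ≤ 2 (1/(p-2) - 1/(p-1))`... use `1/(p(p-2)) ≤ 1/((p-2)(p-1))·... `
  have h1 : ∏ p ∈ S, (1 + 1 / ((p : ℝ) * ((p : ℝ) - 2))) ≤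
      ∏ p ∈ S, Real.exp (1 / ((p : ℝ) * ((p : ℝ) - 2))) := by
    refine Finset.prod_le_prod (fun p hp => ?_) fun p hp => ?_
    · have : (3 : ℝ) ≤ p := hu.trans (hmem p hp).2
      have h' : 0 ≤ 1 / ((p : ℝ) * ((p : ℝ) - 2)) := div_nonneg zero_le_one (by nlinarith)
      linarith
    · linarith [Real.add_one_le_exp (1 / ((p : ℝ) * ((p : ℝ) - 2)))]
  refine h1.trans ?_
  rw [← Real.exp_sum, Real.exp_le_exp]
  -- `∑_{p ∈ S} 1/(p(p-2)) ≤ ∑_{n ∈ Ico ⌈u⌉ ⌈z⌉} 2/((n-1) n)`-type telescoping: use `1/(p(p-2)) ≤ 1/(p-2) - 1/(p-1)` hmm equals 1/((p-2)(p-1)) ≥ 1/(p(p-2))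
  have h2 : ∑ p ∈ S, 1 / ((p : ℝ) * ((p : ℝ) - 2)) ≤
      ∑ n ∈ Finset.Ico ⌈u⌉₊ ⌈z⌉₊, (1 / ((n : ℝ) - 2) - 1 / ((n : ℝ) - 1)) := by
    have hsub : S ⊆ Finset.Ico ⌈u⌉₊ ⌈z⌉₊ := fun p hp => by
      rw [hS, Finset.mem_filter, Nat.primesBelow, Finset.mem_filter, Finset.mem_range] at hp
      rw [Finset.mem_Ico]
      exact ⟨Nat.ceil_le.mpr hp.2, hp.1.1⟩
    refine (Finset.sum_le_sum fun p hp => ?_).trans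
      (Finset.sum_le_sum_of_subset_of_nonneg hsub fun n hn _ => ?_)
    · have h3 : (3 : ℝ) ≤ p := hu.trans (hmem p hp).2
      rw [div_sub_div _ _ (by linarith) (by linarith), div_le_div_iff₀ (by nlinarith) (by nlinarith)]
      nlinarith
    · have h3 : (3 : ℝ) ≤ n := by
        have := (Finset.mem_Ico.mp hn).1
        have h' : u ≤ (n : ℝ) := Nat.ceil_le.mp this
        linarith
      rw [div_sub_div _ _ (by linarith) (by linarith)]
      apply div_nonneg <;> nlinarith
  refine h2.trans ?_
  -- telescoping sum `≤ 1/(⌈u⌉ - 2) ≤ 1/(u-2) ≤ 2/(u-2)`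
  have htel : ∀ m : ℕ, ⌈u⌉₊ ≤ m →
      ∑ n ∈ Finset.Ico ⌈u⌉₊ m, (1 / ((n : ℝ) - 2) - 1 / ((n : ℝ) - 1)) =
        1 / ((⌈u⌉₊ : ℝ) - 2) - 1 / ((m : ℝ) - 2) := by
    intro m hm
    induction m, hm using Nat.le_induction with
    | base => simp
    | succ k hk ih =>
      rw [Finset.sum_Ico_succ_top hk, ih]
      push_cast
      ring
  have hcu : u ≤ (⌈u⌉₊ : ℝ) := Nat.le_ceil u
  by_cases hzu : ⌈u⌉₊ ≤ ⌈z⌉₊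
  · rw [htel _ hzu]
    have hz3 : (3 : ℝ) ≤ (⌈z⌉₊ : ℝ) := by
      have : (⌈u⌉₊ : ℝ) ≤ (⌈z⌉₊ : ℝ) := by exact_mod_cast hzu
      linarith
    have ha : 1 / ((⌈u⌉₊ : ℝ) - 2) ≤ 1 / (u - 2) :=
      div_le_div_of_nonneg_left zero_le_one (by linarith) (by linarith)
    have hb : 0 ≤ 1 / ((⌈z⌉₊ : ℝ) - 2) := div_nonneg zero_le_one (by linarith)
    have hc : 0 ≤ 1 / (u - 2) := div_nonneg zero_le_one (by linarith)
    have hc' : 2 / (u - 2) = 2 * (1 / (u - 2)) := by ring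
    linarith
  · rw [Finset.Ico_eq_empty (by omega), Finset.sum_empty]
    exact div_nonneg zero_le_two (by linarith)

/-- Core of the Mertens bound: given the Mertens approximation `|log n · ∏_{p ≤ n}(1 − 1/p) − e^{−γ}|
< η₁ e^{−γ}` for `n ≥ N₀` (`0 < η₁ ≤ 1/10`), for `u` beyond an explicit threshold and `u < z`,
`∏_{u ≤ p < z} (1 − 1/(p−1))⁻¹ ≤ (1+η₁)(1+2η₁)/(1−η₁)² · log z / log u`. [folklore] -/
theorem prod_one_sub_inv_totient_inv_le_core {η₁ : ℝ} (hη₁0 : 0 < η₁) (hη₁1 : η₁ ≤ 1 / 10) {N₀ : ℕ}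
    (hN₀ : ∀ n : ℕ, N₀ ≤ n → |Real.log n * ∏ p ∈ Nat.primesLE n, (1 - (p : ℝ)⁻¹) -
      Real.exp (-Real.eulerMascheroniConstant)| < η₁ * Real.exp (-Real.eulerMascheroniConstant))
    {u z : ℝ} (hu3 : 3 ≤ u) (huN : (N₀ : ℝ) + 2 ≤ u) (hu2 : Real.exp (Real.log 2 / η₁) ≤ u)
    (hu4 : 1 + 2 / η₁ + 2 ≤ u) (huz : u < z) :
    ∏ p ∈ (Nat.primesBelow ⌈z⌉₊).filter (fun p : ℕ => u ≤ (p : ℝ)), (1 - 1 / ((p : ℝ) - 1))⁻¹ ≤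
      (1 + η₁) / (1 - η₁) ^ 2 * (1 + 2 * η₁) * (Real.log z / Real.log u) := by
  have hc0 : 0 < Real.exp (-Real.eulerMascheroniConstant) := Real.exp_pos _
  have hmem : ∀ p ∈ (Nat.primesBelow ⌈z⌉₊).filter (fun p : ℕ => u ≤ (p : ℝ)),
      p.Prime ∧ u ≤ (p : ℝ) ∧ (p : ℝ) < z := fun p hp => by
    rw [Finset.mem_filter, Nat.primesBelow, Finset.mem_filter, Finset.mem_range, Nat.lt_ceil] at hp
    exact ⟨hp.1.2, hp.2, hp.1.1⟩
  -- factorisation `(1 - 1/(p-1))⁻¹ = (1 - 1/p)⁻¹ (1 + 1/(p(p-2)))`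
  have hfac : ∏ p ∈ (Nat.primesBelow ⌈z⌉₊).filter (fun p : ℕ => u ≤ (p : ℝ)), (1 - 1 / ((p : ℝ) - 1))⁻¹ =
      (∏ p ∈ (Nat.primesBelow ⌈z⌉₊).filter (fun p : ℕ => u ≤ (p : ℝ)), (1 - (p : ℝ)⁻¹)⁻¹) *
        ∏ p ∈ (Nat.primesBelow ⌈z⌉₊).filter (fun p : ℕ => u ≤ (p : ℝ)),
          (1 + 1 / ((p : ℝ) * ((p : ℝ) - 2))) := by
    rw [← Finset.prod_mul_distrib]
    refine Finset.prod_congr rfl fun p hp => ?_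
    have h3 : (3 : ℝ) ≤ p := hu3.trans (hmem p hp).2.1
    have h0 : (p : ℝ) ≠ 0 := by positivity
    have h1 : (p : ℝ) - 1 ≠ 0 := by linarith
    have h2 : (p : ℝ) - 2 ≠ 0 := by linarith
    rw [show 1 - 1 / ((p : ℝ) - 1) = ((p : ℝ) - 2) / ((p : ℝ) - 1) by field_simp; ring,
      show 1 - (p : ℝ)⁻¹ = ((p : ℝ) - 1) / p by field_simp,
      show 1 + 1 / ((p : ℝ) * ((p : ℝ) - 2)) = ((p : ℝ) - 1) ^ 2 / ((p : ℝ) * ((p : ℝ) - 2)) by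
        field_simp; ring,
      inv_div, inv_div, div_mul_div_comm, div_eq_div_iff h2 (by positivity)]
    ring
  -- the second factor
  have hB : ∏ p ∈ (Nat.primesBelow ⌈z⌉₊).filter (fun p : ℕ => u ≤ (p : ℝ)),
      (1 + 1 / ((p : ℝ) * ((p : ℝ) - 2))) ≤ 1 + 2 * η₁ := by
    refine (prod_one_add_inv_mul_sub_two_le (z := z) hu3).trans ?_
    have ht : 2 / (u - 2) ≤ η₁ := by
      rw [div_le_iff₀ (by linarith)]
      have h' : 2 / η₁ ≤ u - 3 := by linarith
      rw [div_le_iff₀ hη₁0] at h'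
      nlinarith
    calc Real.exp (2 / (u - 2)) ≤ Real.exp η₁ := Real.exp_le_exp.mpr ht
      _ ≤ 1 + 2 * η₁ := by
          have h := Real.abs_exp_sub_one_sub_id_le (x := η₁) (by rw [abs_of_pos hη₁0]; linarith)
          rw [abs_le] at h
          nlinarith [h.2]
  have hB0 : 0 ≤ ∏ p ∈ (Nat.primesBelow ⌈z⌉₊).filter (fun p : ℕ => u ≤ (p : ℝ)),
      (1 + 1 / ((p : ℝ) * ((p : ℝ) - 2))) :=
    Finset.prod_nonneg fun p hp => by
      have h3 : (3 : ℝ) ≤ p := hu3.trans (hmem p hp).2.1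
      have : 0 ≤ 1 / ((p : ℝ) * ((p : ℝ) - 2)) := div_nonneg zero_le_one (by nlinarith)
      linarith
  -- integer points `nu = ⌈u⌉ - 1`, `nz = ⌈z⌉ - 1`
  have hcu : u ≤ (⌈u⌉₊ : ℝ) := Nat.le_ceil u
  have hcu' : (⌈u⌉₊ : ℝ) < u + 1 := Nat.ceil_lt_add_one (by linarith)
  have hcz : z ≤ (⌈z⌉₊ : ℝ) := Nat.le_ceil z
  have hcz' : (⌈z⌉₊ : ℝ) < z + 1 := Nat.ceil_lt_add_one (by linarith)
  have hnu1 : 1 ≤ ⌈u⌉₊ := Nat.ceil_pos.mpr (by linarith)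
  have hnz1 : 1 ≤ ⌈z⌉₊ := Nat.ceil_pos.mpr (by linarith)
  have hnuR : ((⌈u⌉₊ - 1 : ℕ) : ℝ) = (⌈u⌉₊ : ℝ) - 1 := by rw [Nat.cast_sub hnu1, Nat.cast_one]
  have hnzR : ((⌈z⌉₊ - 1 : ℕ) : ℝ) = (⌈z⌉₊ : ℝ) - 1 := by rw [Nat.cast_sub hnz1, Nat.cast_one]
  have hnu_ge : u - 1 ≤ ((⌈u⌉₊ - 1 : ℕ) : ℝ) := by rw [hnuR]; linarith
  have hnz_ge : z - 1 ≤ ((⌈z⌉₊ - 1 : ℕ) : ℝ) := by rw [hnzR]; linarith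
  have hnz_le : ((⌈z⌉₊ - 1 : ℕ) : ℝ) < z := by rw [hnzR]; linarith
  have hnuN : N₀ ≤ ⌈u⌉₊ - 1 := by
    have : (N₀ : ℝ) ≤ ((⌈u⌉₊ - 1 : ℕ) : ℝ) := by linarith
    exact_mod_cast this
  have hnzN : N₀ ≤ ⌈z⌉₊ - 1 := by
    have : (N₀ : ℝ) ≤ ((⌈z⌉₊ - 1 : ℕ) : ℝ) := by linarith
    exact_mod_cast this
  have hlogu : 0 < Real.log u := Real.log_pos (by linarith)
  have hlogz : 0 < Real.log z := Real.log_pos (by linarith)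
  have hlognz_le : Real.log ((⌈z⌉₊ - 1 : ℕ) : ℝ) ≤ Real.log z :=
    Real.log_le_log (by linarith) hnz_le.le
  have hWpos : ∀ n : ℕ, 0 < ∏ p ∈ Nat.primesLE n, (1 - (p : ℝ)⁻¹) := fun n =>
    Finset.prod_pos fun p hp => by
      have h2 : (2 : ℝ) ≤ p := by exact_mod_cast (Nat.mem_primesLE.mp hp).2.two_le
      have : (p : ℝ)⁻¹ ≤ 1 / 2 := by
        rw [inv_eq_one_div]; exact div_le_div_of_nonneg_left zero_le_one two_pos h2
      linarith
  obtain ⟨Wu, hWu⟩ : ∃ W : ℝ, W = ∏ p ∈ Nat.primesLE (⌈u⌉₊ - 1), (1 - (p : ℝ)⁻¹) := ⟨_, rfl⟩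
  obtain ⟨Wz, hWz⟩ : ∃ W : ℝ, W = ∏ p ∈ Nat.primesLE (⌈z⌉₊ - 1), (1 - (p : ℝ)⁻¹) := ⟨_, rfl⟩
  have hWu0 : 0 < Wu := hWu ▸ hWpos _
  have hWz0 : 0 < Wz := hWz ▸ hWpos _
  have hU : Real.log ((⌈u⌉₊ - 1 : ℕ) : ℝ) * Wu ≤ (1 + η₁) * Real.exp (-Real.eulerMascheroniConstant) := by
    have h := (abs_lt.mp (hN₀ _ hnuN)).2
    rw [← hWu] at h
    linarith
  have hZ : (1 - η₁) * Real.exp (-Real.eulerMascheroniConstant) ≤ Real.log ((⌈z⌉₊ - 1 : ℕ) : ℝ) * Wz := by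
    have h := (abs_lt.mp (hN₀ _ hnzN)).1
    rw [← hWz] at h
    linarith
  -- `Wz = Wu * ∏_{u ≤ p < z} (1 - 1/p)`
  have hsplit : Wz = Wu * ∏ p ∈ (Nat.primesBelow ⌈z⌉₊).filter (fun p : ℕ => u ≤ (p : ℝ)),
      (1 - (p : ℝ)⁻¹) := by
    rw [hWz, hWu, ← primesBelow_ceil_eq_primesLE, ← primesBelow_ceil_eq_primesLE]
    exact prod_primesBelow_split huz.le _
  have hA : ∏ p ∈ (Nat.primesBelow ⌈z⌉₊).filter (fun p : ℕ => u ≤ (p : ℝ)), (1 - (p : ℝ)⁻¹)⁻¹ =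
      Wu / Wz := by
    rw [hsplit, Finset.prod_inv_distrib]
    field_simp
  -- `log (⌈u⌉ - 1) ≥ (1 - η₁) log u`
  have hlog2u : Real.log 2 ≤ η₁ * Real.log u := by
    have h := Real.log_le_log (Real.exp_pos _) hu2
    rw [Real.log_exp] at h
    rwa [div_le_iff₀ hη₁0, mul_comm] at h
  have hlognu_ge : (1 - η₁) * Real.log u ≤ Real.log ((⌈u⌉₊ - 1 : ℕ) : ℝ) := by
    have h1 : Real.log (u / 2) ≤ Real.log ((⌈u⌉₊ - 1 : ℕ) : ℝ) :=
      Real.log_le_log (by positivity) (by linarith)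
    rw [Real.log_div (by linarith) two_ne_zero] at h1
    have : (1 - η₁) * Real.log u = Real.log u - η₁ * Real.log u := by ring
    linarith
  -- the first factor
  have h1 : Wu * ((1 - η₁) * Real.log u) ≤ (1 + η₁) * Real.exp (-Real.eulerMascheroniConstant) :=
    calc Wu * ((1 - η₁) * Real.log u) ≤ Wu * Real.log ((⌈u⌉₊ - 1 : ℕ) : ℝ) :=
          mul_le_mul_of_nonneg_left hlognu_ge hWu0.le
      _ = Real.log ((⌈u⌉₊ - 1 : ℕ) : ℝ) * Wu := mul_comm _ _
      _ ≤ _ := hU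
  have h2 : (1 - η₁) * Real.exp (-Real.eulerMascheroniConstant) ≤ Real.log z * Wz :=
    hZ.trans (mul_le_mul_of_nonneg_right hlognz_le hWz0.le)
  have hη₁' : 0 < 1 - η₁ := by linarith
  have h3 : Wu * Real.log u * (1 - η₁) ^ 2 * Real.exp (-Real.eulerMascheroniConstant) ≤
      (1 + η₁) * (Real.log z * Wz) * Real.exp (-Real.eulerMascheroniConstant) :=
    calc Wu * Real.log u * (1 - η₁) ^ 2 * Real.exp (-Real.eulerMascheroniConstant)
        = (Wu * ((1 - η₁) * Real.log u)) * ((1 - η₁) * Real.exp (-Real.eulerMascheroniConstant)) := by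
          ring
      _ ≤ ((1 + η₁) * Real.exp (-Real.eulerMascheroniConstant)) *
            ((1 - η₁) * Real.exp (-Real.eulerMascheroniConstant)) :=
          mul_le_mul_of_nonneg_right h1 (by positivity)
      _ ≤ ((1 + η₁) * Real.exp (-Real.eulerMascheroniConstant)) * (Real.log z * Wz) :=
          mul_le_mul_of_nonneg_left h2 (by positivity)
      _ = (1 + η₁) * (Real.log z * Wz) * Real.exp (-Real.eulerMascheroniConstant) := by ring
  have h4 : Wu * Real.log u * (1 - η₁) ^ 2 ≤ (1 + η₁) * (Real.log z * Wz) :=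
    le_of_mul_le_mul_right h3 hc0
  have hratio : Wu / Wz ≤ (1 + η₁) / (1 - η₁) ^ 2 * (Real.log z / Real.log u) := by
    rw [div_le_iff₀ hWz0,
      show (1 + η₁) / (1 - η₁) ^ 2 * (Real.log z / Real.log u) * Wz =
        ((1 + η₁) * (Real.log z * Wz)) / ((1 - η₁) ^ 2 * Real.log u) by
          rw [div_mul_div_comm, div_mul_eq_mul_div]; ring,
      le_div_iff₀ (by positivity)]
    calc Wu * ((1 - η₁) ^ 2 * Real.log u) = Wu * Real.log u * (1 - η₁) ^ 2 := by ring
      _ ≤ (1 + η₁) * (Real.log z * Wz) := h4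
  -- combine
  rw [hfac, hA]
  have hlogratio : 0 ≤ Real.log z / Real.log u := by positivity
  calc Wu / Wz * ∏ p ∈ (Nat.primesBelow ⌈z⌉₊).filter (fun p : ℕ => u ≤ (p : ℝ)),
        (1 + 1 / ((p : ℝ) * ((p : ℝ) - 2)))
      ≤ ((1 + η₁) / (1 - η₁) ^ 2 * (Real.log z / Real.log u)) * (1 + 2 * η₁) :=
        mul_le_mul hratio hB hB0 (by positivity)
    _ = (1 + η₁) / (1 - η₁) ^ 2 * (1 + 2 * η₁) * (Real.log z / Real.log u) := by ring

/-- **Mertens for the linear-sieve hypothesis.** For every `η > 0` there is `u₀ ≥ 3` such that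
`∏_{u ≤ p < z} (1 − 1/(p−1))⁻¹ ≤ (1 + η) log z / log u` whenever `u₀ ≤ u < z`
(Nathanson, proof of (9.34) on pp. 169–170 via his Thm 6.9; here from Mertens' theorem
`log x ∏_{p ≤ x} (1 − 1/p) → e^{−γ}`, `Literature.NumberTheory.LFunctions.Mertens.tendsto_log_mul_prod_one_sub_inv_nat`, and
`(1 − 1/(p−1))⁻¹ = (1 − 1/p)⁻¹ (1 + 1/(p(p−2)))`). [cite: Nathanson1996, §10.3 (proof of (9.34))] -/
theorem exists_prod_one_sub_inv_totient_inv_le {η : ℝ} (hη : 0 < η) :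
    ∃ u₀ : ℝ, 3 ≤ u₀ ∧ ∀ u z : ℝ, u₀ ≤ u → u < z →
      ∏ p ∈ (Nat.primesBelow ⌈z⌉₊).filter (fun p : ℕ => u ≤ (p : ℝ)), (1 - 1 / ((p : ℝ) - 1))⁻¹ ≤
        (1 + η) * (Real.log z / Real.log u) := by
  set η₁ := min η 1 / 10 with hη₁
  have hη₁0 : 0 < η₁ := by positivity
  have hη₁1 : η₁ ≤ 1 / 10 := by
    have := min_le_right η 1
    rw [hη₁]; linarith
  have hη₁η : 10 * η₁ ≤ η := by
    have := min_le_left η 1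
    rw [hη₁]; linarith
  have hc0 : 0 < Real.exp (-Real.eulerMascheroniConstant) := Real.exp_pos _
  have hev : ∀ᶠ n : ℕ in atTop, |Real.log n * ∏ p ∈ Nat.primesLE n, (1 - (p : ℝ)⁻¹) -
      Real.exp (-Real.eulerMascheroniConstant)| < η₁ * Real.exp (-Real.eulerMascheroniConstant) :=
    (Metric.tendsto_nhds.mp Literature.NumberTheory.LFunctions.Mertens.tendsto_log_mul_prod_one_sub_inv_nat) _ (by positivity)
  obtain ⟨N₀, hN₀⟩ := eventually_atTop.mp hev
  refine ⟨max (max ((N₀ : ℝ) + 2) 3) (max (Real.exp (Real.log 2 / η₁)) (1 + 2 / η₁ + 2)),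
    le_trans (le_max_right _ _) (le_max_left _ _), fun u z hu huz => ?_⟩
  have hu3 : 3 ≤ u := le_trans (le_trans (le_max_right _ _) (le_max_left _ _)) hu
  have huN : (N₀ : ℝ) + 2 ≤ u := le_trans (le_trans (le_max_left _ _) (le_max_left _ _)) hu
  have hu2 : Real.exp (Real.log 2 / η₁) ≤ u :=
    le_trans (le_trans (le_max_left _ _) (le_max_right _ _)) hu
  have hu4 : 1 + 2 / η₁ + 2 ≤ u := le_trans (le_trans (le_max_right _ _) (le_max_right _ _)) hu
  refine (prod_one_sub_inv_totient_inv_le_core hη₁0 hη₁1 hN₀ hu3 huN hu2 hu4 huz).trans ?_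
  have hlogratio : 0 ≤ Real.log z / Real.log u :=
    div_nonneg (Real.log_nonneg (by linarith)) (Real.log_nonneg (by linarith))
  refine mul_le_mul_of_nonneg_right ?_ hlogratio
  -- `(1+η₁)(1+2η₁)/(1-η₁)² ≤ 1 + 10 η₁ ≤ 1 + η`
  have hη₁' : 0 < (1 - η₁) ^ 2 := by
    have : 0 < 1 - η₁ := by linarith
    positivity
  rw [div_mul_eq_mul_div, div_le_iff₀ hη₁']
  have hid : (1 + 10 * η₁) * (1 - η₁) ^ 2 - (1 + η₁) * (1 + 2 * η₁) =
      η₁ * (5 - 21 * η₁ + 10 * η₁ ^ 2) := by ring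
  have hpos : 0 ≤ η₁ * (5 - 21 * η₁ + 10 * η₁ ^ 2) := by
    have : 0 ≤ 5 - 21 * η₁ + 10 * η₁ ^ 2 := by nlinarith
    positivity
  nlinarith

/-! ### The prime number theorem and Bombieri–Vinogradov in the forms used -/

/-- PNT, two-sided: for every `η > 0`, eventually `(1−η) x/log x ≤ π(x) ≤ (1+η) x/log x`
(from the tree's `Literature.NumberTheory.Sieve.tendsto_primeCounting_mul_log_div`, `π(N) log N/N → 1`).
[cite: MontgomeryVaughan2007, §8.1 (8.1)] -/
theorem eventually_primeCounting_bounds {η : ℝ} (hη : 0 < η) :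
    ∀ᶠ x : ℕ in atTop, (1 - η) * ((x : ℝ) / Real.log x) ≤ Nat.primeCounting x ∧
      (Nat.primeCounting x : ℝ) ≤ (1 + η) * ((x : ℝ) / Real.log x) := by
  have h := (Metric.tendsto_nhds.mp Literature.NumberTheory.Sieve.tendsto_primeCounting_mul_log_div) η hη
  filter_upwards [h, eventually_ge_atTop 2] with x hx hx2
  have hx1 : (1 : ℝ) < x := by exact_mod_cast (show 1 < x by omega)
  have hx0 : (0 : ℝ) < x := by linarith
  have hlog : 0 < Real.log x := Real.log_pos hx1
  rw [Real.dist_eq, abs_lt] at hx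
  have hL : 0 < (x : ℝ) / Real.log x := by positivity
  have hid : (Nat.primeCounting x : ℝ) =
      (Nat.primeCounting x : ℝ) * Real.log x / x * ((x : ℝ) / Real.log x) := by
    field_simp
  rw [hid]
  constructor
  · exact mul_le_mul_of_nonneg_right (by linarith [hx.1]) hL.le
  · exact mul_le_mul_of_nonneg_right (by linarith [hx.2]) hL.le

/-- **Bombieri–Vinogradov, `π`-form, for one residue per modulus.** Under
`BombieriVinogradovStatement`, for every `θ₁ < 1/2` and `A > 0` there is `C` such that for all large
`x ∈ ℕ` and EVERY choice of reduced residues `a_q`,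
`∑_{q ≤ x^{θ₁}} |π(x; q, a_q) − π(x)/φ(q)| ≤ C x/(log x)^A`
(from the PROVED `π`-form `Literature.NumberTheory.Sieve.BombieriVinogradovStatement.primesHaveLevelPi`, Iwaniec–Kowalski
Thm 17.1, whose summand is the maximum over `y ≤ x` and `a`). [cite: IwaniecKowalski2004, Theorem 17.1] -/
theorem eventually_sum_abs_primeCountingDisc_le (hBV : BombieriVinogradovStatement) {θ₁ : ℝ}
    (hθ₁ : θ₁ < 1 / 2) {A : ℝ} (hA : 0 < A) :
    ∃ C : ℝ, ∀ᶠ x : ℕ in atTop, ∀ a : (q : ℕ) → (ZMod q)ˣ,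
      ∑ q ∈ Icc 1 ⌊(x : ℝ) ^ θ₁⌋₊, |primeCountingDisc q (a q) x| ≤ C * x / Real.log x ^ A := by
  set θ := (θ₁ + 1 / 2) / 2 with hθ
  have hθlt : θ < 1 / 2 := by rw [hθ]; linarith
  have hε : 0 < θ - θ₁ := by rw [hθ]; linarith
  have hPi := hBV.primesHaveLevelPi hθlt A hA (θ - θ₁) hε
  rw [show θ - (θ - θ₁) = θ₁ by ring] at hPi
  obtain ⟨C, hC⟩ := hPi.bound
  refine ⟨C, ?_⟩
  filter_upwards [tendsto_natCast_atTop_atTop.eventually hC, eventually_ge_atTop 1] with x hx hx1 a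
  rw [Real.norm_of_nonneg (Finset.sum_nonneg fun q _ =>
      Real.iSup_nonneg fun y => Real.iSup_nonneg fun a => abs_nonneg _),
    Real.norm_of_nonneg (by
      have : (1 : ℝ) ≤ x := by exact_mod_cast hx1
      have : 0 ≤ Real.log (x : ℝ) := Real.log_nonneg this
      positivity)] at hx
  refine le_trans (Finset.sum_le_sum fun q hq => ?_) (by rw [mul_div_assoc]; exact hx)
  have hq0 : q ≠ 0 := Nat.one_le_iff_ne_zero.mp (Finset.mem_Icc.mp hq).1
  exact abs_primeCountingDisc_le_iSup hq0 (a q) hx1 (by simp)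


/-! ### The twin instance of the linear sieve: identification of the objects -/

/-- The weights of the twin problem: `a(n) = 1` if `n ∈ 𝒜(x) = {p + 2 : 2 < p ≤ x}`, else `0`.
[cite: Nathanson1996, (10.6)] -/
def twinWeight (x : ℕ) (n : ℕ) : ℝ :=
  if n ∈ twinSieveSet x then 1 else 0

/-- `0 ≤ a(n)`. [folklore] -/
theorem twinWeight_nonneg (x n : ℕ) : 0 ≤ twinWeight x n := by
  unfold twinWeight; split_ifs <;> norm_num

/-- **The twin sifted sequence** at `x` (Nathanson §10.2–10.4 with `N − p ↦ p + 2`): weights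
`a(n) = 1_{𝒜(x)}(n)`, density `g(d) = 1/φ(d)` on odd `d` (`Literature.shiftedPrimesDensity 2`, `0` on even
`d`), size `X = |𝒜(x)| = π(x) − 1` (constant in the height). [cite: Nathanson1996, (10.6) and §10.3] -/
def twinSeq (x : ℕ) : SieveSequence where
  a := twinWeight x
  a_nonneg := twinWeight_nonneg x
  size := fun _ => (Nat.primeCounting x : ℝ) - 1
  density := shiftedPrimesDensity 2
  density_mult := isMultiplicative_shiftedPrimesDensity 2

/-- The sifting primes of the twin problem below `z`: `P = ∏_{2 < p < z} p` (Nathanson's `P(z)` for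
`𝒫` = odd primes). [cite: Nathanson1996, Thm 9.7 (P(z))] -/
def oddPrimesProd (z : ℝ) : ℕ :=
  ∏ p ∈ (Nat.primesBelow ⌈z⌉₊).filter (fun p => p ≠ 2), p

/-- Elements of `𝒜(x)` are odd and `≥ 5`. [folklore] -/
theorem odd_of_mem_twinSieveSet {x n : ℕ} (hn : n ∈ twinSieveSet x) : Odd n ∧ 5 ≤ n := by
  obtain ⟨p, hp, h2, -, rfl⟩ := mem_twinSieveSet.mp hn
  have hodd : Odd p := hp.odd_of_ne_two (by omega)
  refine ⟨hodd.add_even even_two, ?_⟩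
  have := hp.two_le
  rcases hodd with ⟨k, rfl⟩
  omega

/-- `∑_{n ∈ s} a(n) = #(s ∩ 𝒜(x))`. [folklore] -/
theorem sum_twinWeight (x : ℕ) (s : Finset ℕ) :
    ∑ n ∈ s, twinWeight x n = #(s.filter fun n => n ∈ twinSieveSet x) := by
  classical
  rw [Finset.card_filter, Nat.cast_sum]
  refine Finset.sum_congr rfl fun n _ => ?_
  unfold twinWeight
  split_ifs <;> simp

/-- `#𝒜(x) = π(x) − 1` for `x ≥ 2`. [folklore] -/
theorem card_twinSieveSet {x : ℕ} (hx : 2 ≤ x) : (#(twinSieveSet x) : ℝ) = Nat.primeCounting x - 1 := by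
  rw [twinSieveSet, Finset.card_map]
  have h : insert 2 ((Finset.Ioc 2 x).filter Nat.Prime) = Nat.primesLE x := by
    ext p
    rw [Finset.mem_insert, Finset.mem_filter, Finset.mem_Ioc, Nat.mem_primesLE]
    constructor
    · rintro (rfl | ⟨⟨h2, hx'⟩, hp⟩)
      · exact ⟨hx, Nat.prime_two⟩
      · exact ⟨hx', hp⟩
    · rintro ⟨hpx, hp⟩
      by_cases h2 : p = 2
      · exact Or.inl h2
      · exact Or.inr ⟨⟨lt_of_le_of_ne hp.two_le (Ne.symm h2), hpx⟩, hp⟩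
  have hcard := congrArg Finset.card h
  rw [Finset.card_insert_of_notMem (by simp), Nat.primesLE_card_eq_primeCounting] at hcard
  have : ((#((Finset.Ioc 2 x).filter Nat.Prime) + 1 : ℕ) : ℝ) = Nat.primeCounting x := by
    exact_mod_cast hcard
  push_cast at this
  linarith

/-- The support cut at height `x + 2`: `⌊x + 2⌋ = x + 2` and `𝒜(x) ⊆ (0, x + 2]`. [folklore] -/
theorem filter_Ioc_mem_twinSieveSet (x : ℕ) :
    (Finset.Ioc 0 ⌊((x + 2 : ℕ) : ℝ)⌋₊).filter (fun n => n ∈ twinSieveSet x) = twinSieveSet x := by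
  rw [Nat.floor_natCast]
  ext n
  rw [Finset.mem_filter]
  exact ⟨fun h => h.2, fun h => ⟨twinSieveSet_subset_Ioc x h, h⟩⟩

/-- `X = |A|`: the size of `twinSeq x` is its total mass at height `x + 2` (hypothesis (9.38) of
Theorem 9.7). [folklore] -/
theorem twinSeq_size_eq {x : ℕ} (hx : 2 ≤ x) :
    (twinSeq x).size ((x + 2 : ℕ) : ℝ) = ∑ n ∈ Finset.Ioc 0 ⌊((x + 2 : ℕ) : ℝ)⌋₊, (twinSeq x).a n := by
  change (Nat.primeCounting x : ℝ) - 1 = ∑ n ∈ Finset.Ioc 0 ⌊((x + 2 : ℕ) : ℝ)⌋₊, twinWeight x n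
  rw [sum_twinWeight, filter_Ioc_mem_twinSieveSet, card_twinSieveSet hx]

/-- Membership in the index set of `oddPrimesProd`. [folklore] -/
theorem mem_filter_primesBelow_ne_two {z : ℝ} {p : ℕ} :
    p ∈ (Nat.primesBelow ⌈z⌉₊).filter (fun p => p ≠ 2) ↔ p.Prime ∧ (p : ℝ) < z ∧ p ≠ 2 := by
  rw [Finset.mem_filter, Nat.primesBelow, Finset.mem_filter, Finset.mem_range, Nat.lt_ceil]
  tauto

/-- The prime factors of `P = ∏_{2<p<z} p` are the odd primes `< z`. [folklore] -/
theorem primeFactors_oddPrimesProd (z : ℝ) :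
    (oddPrimesProd z).primeFactors = (Nat.primesBelow ⌈z⌉₊).filter (fun p => p ≠ 2) :=
  Nat.primeFactors_prod fun _ hp => (mem_filter_primesBelow_ne_two.mp hp).1

/-- `P ∣ P(z) = ∏_{p<z} p`. [folklore] -/
theorem oddPrimesProd_dvd_primesProdBelow (z : ℝ) : oddPrimesProd z ∣ primesProdBelow z :=
  Finset.prod_dvd_prod_of_subset _ _ _ (Finset.filter_subset _ _)

/-- `P` is squarefree. [folklore] -/
theorem squarefree_oddPrimesProd (z : ℝ) : Squarefree (oddPrimesProd z) :=
  (squarefree_primesProdBelow z).squarefree_of_dvd (oddPrimesProd_dvd_primesProdBelow z)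

/-- `P ≠ 0`. [folklore] -/
theorem oddPrimesProd_ne_zero (z : ℝ) : oddPrimesProd z ≠ 0 := (squarefree_oddPrimesProd z).ne_zero

/-- A prime divides `P` iff it is an odd prime `< z`. [folklore] -/
theorem prime_dvd_oddPrimesProd_iff {z : ℝ} {p : ℕ} (hp : p.Prime) :
    p ∣ oddPrimesProd z ↔ (p : ℝ) < z ∧ p ≠ 2 := by
  have h : p ∣ oddPrimesProd z ↔ p ∈ (oddPrimesProd z).primeFactors := by
    rw [Nat.mem_primeFactors]
    exact ⟨fun hd => ⟨hp, hd, oddPrimesProd_ne_zero z⟩, fun h => h.2.1⟩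
  rw [h, primeFactors_oddPrimesProd, mem_filter_primesBelow_ne_two]
  tauto

/-- For an odd `n ≥ 1`: `n` is coprime to `P = ∏_{2 < p < z} p` iff `n` has no prime factor `< z`.
[folklore] -/
theorem coprime_oddPrimesProd_iff_isRough {z : ℝ} {n : ℕ} (hn : Odd n) :
    n.Coprime (oddPrimesProd z) ↔ IsRough ⌈z⌉₊ n := by
  rw [oddPrimesProd, Nat.coprime_prod_right_iff]
  constructor
  · intro h p hp
    rw [Nat.mem_primeFactors] at hp
    by_contra hlt
    push Not at hlt
    have hp2 : p ≠ 2 := by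
      rintro rfl
      exact hn.not_two_dvd_nat hp.2.1
    have hmem : p ∈ (Nat.primesBelow ⌈z⌉₊).filter (fun p => p ≠ 2) := by
      rw [Finset.mem_filter, Nat.primesBelow, Finset.mem_filter, Finset.mem_range]
      exact ⟨⟨hlt, hp.1⟩, hp2⟩
    exact hp.1.one_lt.ne' ((h p hmem).symm.eq_one_of_dvd hp.2.1)
  · intro h p hp
    rw [Finset.mem_filter, Nat.primesBelow, Finset.mem_filter, Finset.mem_range] at hp
    refine ((Nat.Prime.coprime_iff_not_dvd hp.1.2).mpr fun hdvd => ?_).symm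
    have hn0 : n ≠ 0 := fun h0 => by simp [h0] at hn
    have : ⌈z⌉₊ ≤ p := h p (Nat.mem_primeFactors.mpr ⟨hp.1.2, hdvd, hn0⟩)
    omega

/-- `S(A, P; x + 2)` for the twin sequence is the rough count of `𝒜(x)`:
`#{n ∈ 𝒜(x) : no prime factor < z}`. [folklore] -/
theorem sifted_twinSeq_eq (x : ℕ) (z : ℝ) :
    (twinSeq x).sifted ((x + 2 : ℕ) : ℝ) (oddPrimesProd z) = roughCount (twinSieveSet x) ⌈z⌉₊ := by
  classical
  change ∑ n ∈ (Finset.Ioc 0 ⌊((x + 2 : ℕ) : ℝ)⌋₊).filter (fun n : ℕ => n.Coprime (oddPrimesProd z)),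
    twinWeight x n = _
  rw [sum_twinWeight, roughCount, Finset.filter_filter, Nat.floor_natCast]
  congr 2
  ext n
  rw [Finset.mem_filter, Finset.mem_filter]
  constructor
  · rintro ⟨-, hcop, hn⟩
    exact ⟨hn, (coprime_oddPrimesProd_iff_isRough (odd_of_mem_twinSieveSet hn).1).mp hcop⟩
  · rintro ⟨hn, hr⟩
    exact ⟨twinSieveSet_subset_Ioc x hn,
      (coprime_oddPrimesProd_iff_isRough (odd_of_mem_twinSieveSet hn).1).mpr hr, hn⟩

/-- The density at an odd prime: `g(p) = 1/(p − 1)`. [folklore] -/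
theorem shiftedPrimesDensity_two_prime {p : ℕ} (hp : p.Prime) (hp2 : p ≠ 2) :
    shiftedPrimesDensity 2 p = 1 / ((p : ℝ) - 1) := by
  rw [shiftedPrimesDensity_apply]
  have hcop : p.Coprime 2 := (Nat.coprime_primes hp Nat.prime_two).mpr hp2
  rw [if_pos ⟨hcop, hp.ne_zero⟩, Nat.totient_prime hp, Nat.cast_sub hp.one_lt.le, Nat.cast_one,
    one_div]

/-- `V(P)` for the twin sequence is `Literature.Chen.sieveProduct 2 z = ∏_{2<p<z} (1 − 1/(p−1))`. [folklore] -/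
theorem densityProduct_twinSeq_eq (x : ℕ) (z : ℝ) :
    (twinSeq x).densityProduct (oddPrimesProd z) = sieveProduct 2 z := by
  rw [SieveSequence.densityProduct, primeFactors_oddPrimesProd, sieveProduct]
  have hset : (Nat.primesBelow ⌈z⌉₊).filter (fun p => p ≠ 2) =
      (Nat.primesBelow ⌈z⌉₊).filter (fun p : ℕ => ¬p ∣ 2) := by
    ext p
    rw [Finset.mem_filter, Finset.mem_filter, Nat.primesBelow, Finset.mem_filter]
    constructor
    · rintro ⟨⟨hr, hp⟩, h2⟩
      refine ⟨⟨hr, hp⟩, fun h => ?_⟩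
      have := Nat.le_of_dvd two_pos h
      have := hp.two_le
      omega
    · rintro ⟨⟨hr, hp⟩, h2⟩
      exact ⟨⟨hr, hp⟩, fun h => h2 (h ▸ dvd_rfl)⟩
  rw [hset]
  refine Finset.prod_congr rfl fun p hp => ?_
  rw [Finset.mem_filter, Nat.primesBelow, Finset.mem_filter] at hp
  have hp2 : p ≠ 2 := fun h => hp.2 (h ▸ dvd_rfl)
  change 1 - shiftedPrimesDensity 2 p = _
  rw [shiftedPrimesDensity_two_prime hp.1.2 hp2]

/-- (9.33) for the twin sequence: `0 ≤ g(p) < 1` at every prime factor of `P` (odd primes).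
[folklore] -/
theorem density_twinSeq_mem_Ico (x : ℕ) (z : ℝ) :
    ∀ p ∈ (oddPrimesProd z).primeFactors, 0 ≤ (twinSeq x).density p ∧ (twinSeq x).density p < 1 := by
  intro p hp
  rw [primeFactors_oddPrimesProd, mem_filter_primesBelow_ne_two] at hp
  change 0 ≤ shiftedPrimesDensity 2 p ∧ shiftedPrimesDensity 2 p < 1
  rw [shiftedPrimesDensity_two_prime hp.1 hp.2.2]
  have h3 : (3 : ℝ) ≤ p := by
    have := lt_of_le_of_ne hp.1.two_le (Ne.symm hp.2.2)
    exact_mod_cast this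
  constructor
  · exact div_nonneg zero_le_one (by linarith)
  · rw [div_lt_one (by linarith)]; linarith

/-- For `d ≥ 2`: `p ≡ d − 2 (mod d)` iff `d ∣ p + 2`. [folklore] -/
theorem modEq_sub_two_iff {d p : ℕ} (hd : 2 ≤ d) : p ≡ d - 2 [MOD d] ↔ d ∣ p + 2 := by
  rw [Nat.modEq_iff_dvd]
  have : ((d - 2 : ℕ) : ℤ) - p = (d : ℤ) - ((p + 2 : ℕ) : ℤ) := by
    push_cast [Nat.cast_sub hd]
    ring
  rw [this, dvd_sub_right (dvd_refl (d : ℤ)), Int.natCast_dvd_natCast]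

/-- An odd `d ≥ 3` does not divide `4`. [folklore] -/
theorem not_dvd_four_of_odd {d : ℕ} (hd : Odd d) (hd3 : 3 ≤ d) : ¬ d ∣ 4 := by
  intro h
  have h4 : d ≤ 4 := Nat.le_of_dvd (by norm_num) h
  interval_cases d
  · norm_num at h
  · exact (Nat.not_even_iff_odd.mpr hd) (by decide)

/-- The elements of `𝒜(x)` divisible by an odd `d ≥ 3` are the `p + 2` with `p ≤ x` prime and
`p ≡ d − 2 (mod d)`. [folklore] -/
theorem filter_dvd_twinSieveSet_eq {x d : ℕ} (hd : Odd d) (hd3 : 3 ≤ d) :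
    (twinSieveSet x).filter (fun n => d ∣ n) =
      ((Finset.range (x + 1)).filter (fun p => p.Prime ∧ p ≡ d - 2 [MOD d])).map
        (addRightEmbedding 2) := by
  ext n
  rw [Finset.mem_filter, Finset.mem_map]
  constructor
  · rintro ⟨hn, hdn⟩
    obtain ⟨p, hp, h2, hpx, rfl⟩ := mem_twinSieveSet.mp hn
    refine ⟨p, Finset.mem_filter.mpr ⟨Finset.mem_range.mpr (by omega), hp, ?_⟩, rfl⟩
    exact (modEq_sub_two_iff (by omega)).mpr hdn
  · rintro ⟨p, hp, rfl⟩
    rw [Finset.mem_filter, Finset.mem_range] at hp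
    obtain ⟨hpx, hp, hmod⟩ := hp
    have hdvd : d ∣ p + 2 := (modEq_sub_two_iff (by omega)).mp hmod
    have hp2 : 2 < p := by
      by_contra hle
      have : p = 2 := le_antisymm (not_lt.mp hle) hp.two_le
      subst this
      exact not_dvd_four_of_odd hd hd3 hdvd
    simp only [addRightEmbedding_apply]
    exact ⟨mem_twinSieveSet.mpr ⟨p, hp, hp2, by omega, rfl⟩, hdvd⟩

/-- `|A_d| = π(x; d, d − 2)` for odd `d ≥ 3`: the elements of `𝒜(x)` divisible by `d` are the
`p + 2` with `p ≤ x` prime, `p ≡ −2 (mod d)` (Nathanson p. 171, `|A_d| = π(N; d, N) + O(ω(N))`).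
[cite: Nathanson1996, §10.4 (proof of Thm 10.4)] -/
theorem congrSum_twinSeq_eq {x d : ℕ} (hd : Odd d) (hd3 : 3 ≤ d) :
    (twinSeq x).congrSum d ((x + 2 : ℕ) : ℝ) = LevelOfDistribution.primeCountingMod d (d - 2) x := by
  classical
  change ∑ n ∈ (Finset.Ioc 0 ⌊((x + 2 : ℕ) : ℝ)⌋₊).filter (d ∣ ·), twinWeight x n = _
  rw [sum_twinWeight, Finset.filter_filter, Nat.floor_natCast]
  have h1 : (Finset.Ioc 0 (x + 2)).filter (fun n => d ∣ n ∧ n ∈ twinSieveSet x) =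
      (twinSieveSet x).filter (fun n => d ∣ n) := by
    ext n
    rw [Finset.mem_filter, Finset.mem_filter]
    constructor
    · rintro ⟨-, hdn, hn⟩
      exact ⟨hn, hdn⟩
    · rintro ⟨hn, hdn⟩
      exact ⟨twinSieveSet_subset_Ioc x hn, hdn, hn⟩
  rw [h1, filter_dvd_twinSieveSet_eq hd hd3, Finset.card_map, LevelOfDistribution.primeCountingMod]

/-! ### The remainder terms `r(d)` of the twin instance -/

/-- The density at `1`: `g(1) = 1`. [folklore] -/
theorem shiftedPrimesDensity_two_one : shiftedPrimesDensity 2 1 = 1 := by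
  rw [shiftedPrimesDensity_apply, if_pos ⟨Nat.coprime_one_left 2, one_ne_zero⟩, Nat.totient_one,
    Nat.cast_one, inv_one]

/-- The density at an odd `d`: `g(d) = 1/φ(d)`. [folklore] -/
theorem shiftedPrimesDensity_two_odd {d : ℕ} (hd : Odd d) :
    shiftedPrimesDensity 2 d = ((Nat.totient d : ℝ))⁻¹ := by
  rw [shiftedPrimesDensity_apply, if_pos]
  refine ⟨Nat.coprime_two_right.mpr hd, fun h0 => ?_⟩
  simp [h0] at hd

/-- `r(1) = 0` (for `x ≥ 2`). [folklore] -/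
theorem remainder_twinSeq_one {x : ℕ} (hx : 2 ≤ x) :
    (twinSeq x).remainder 1 ((x + 2 : ℕ) : ℝ) = 0 := by
  rw [SieveSequence.remainder, twinSeq_size_eq hx, SieveSequence.congrSum,
    Finset.filter_true_of_mem fun n _ => one_dvd n]
  change _ - shiftedPrimesDensity 2 1 * _ = 0
  rw [shiftedPrimesDensity_two_one, one_mul, sub_self]

/-- `(d − 2, d) = 1` for odd `d ≥ 2`. [folklore] -/
theorem coprime_sub_two_of_odd {d : ℕ} (hd : Odd d) (hd2 : 2 ≤ d) : (d - 2).Coprime d := by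
  have hodd : Odd (d - 2) := Nat.Odd.sub_even hd2 hd even_two
  have h : (d - 2).Coprime (d - 2 + 2) := Nat.coprime_self_add_right.mpr (Nat.coprime_two_right.mpr hodd)
  rwa [Nat.sub_add_cancel hd2] at h

/-- A choice of the residue `−2 (mod q)` as a unit, for every modulus `q` (junk `1` when
`(q − 2, q) ≠ 1`, i.e. for even `q`). [folklore] -/
def negTwoUnit (q : ℕ) : (ZMod q)ˣ :=
  if h : (q - 2).Coprime q then ZMod.unitOfCoprime (q - 2) h else 1

/-- For odd `d ≥ 3`, the unit `negTwoUnit d` has representative `d − 2`. [folklore] -/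
theorem val_negTwoUnit {d : ℕ} (hd : Odd d) (hd3 : 3 ≤ d) :
    ((negTwoUnit d : (ZMod d)ˣ) : ZMod d).val = d - 2 := by
  rw [negTwoUnit, dif_pos (coprime_sub_two_of_odd hd (by omega)), ZMod.coe_unitOfCoprime,
    ZMod.val_cast_of_lt (by omega)]

/-- For odd `d ≥ 3`: `|r(d)| ≤ |π(x; d, −2) − π(x)/φ(d)| + 1`
(`r(d) = |A_d| − g(d)|A| = π(x; d, −2) − (π(x) − 1)/φ(d)`; Nathanson p. 171:
`r(d) = δ(N; d, N) + O(log N)`). [cite: Nathanson1996, §10.4 (proof of Thm 10.4)] -/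
theorem abs_remainder_twinSeq_le {x d : ℕ} (hd : Odd d) (hd3 : 3 ≤ d) :
    |(twinSeq x).remainder d ((x + 2 : ℕ) : ℝ)| ≤
      |primeCountingDisc d (negTwoUnit d : ZMod d) x| + 1 := by
  have hd0 : d ≠ 0 := by omega
  have hφ : (1 : ℝ) ≤ Nat.totient d := by exact_mod_cast Nat.totient_pos.mpr (by omega)
  rw [SieveSequence.remainder, congrSum_twinSeq_eq hd hd3]
  change |(LevelOfDistribution.primeCountingMod d (d - 2) x : ℝ) -
    shiftedPrimesDensity 2 d * ((Nat.primeCounting x : ℝ) - 1)| ≤ _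
  rw [shiftedPrimesDensity_two_odd hd, ← primeCountingMod_sub_div_eq hd0, val_negTwoUnit hd hd3]
  have hid : (LevelOfDistribution.primeCountingMod d (d - 2) x : ℝ) - ((Nat.totient d : ℝ))⁻¹ * ((Nat.primeCounting x : ℝ) - 1) =
      ((LevelOfDistribution.primeCountingMod d (d - 2) x : ℝ) - (Nat.primeCounting x : ℝ) / Nat.totient d) +
        ((Nat.totient d : ℝ))⁻¹ := by
    rw [div_eq_mul_inv]; ring
  rw [hid]
  refine (abs_add_le _ _).trans ?_
  rw [abs_of_pos (by positivity : (0 : ℝ) < ((Nat.totient d : ℝ))⁻¹)]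
  have := inv_le_one_of_one_le₀ hφ
  linarith

/-- A divisor of `P = ∏_{2<p<z} p` is odd. [folklore] -/
theorem odd_of_dvd_oddPrimesProd {z : ℝ} {d : ℕ} (hd : d ∣ oddPrimesProd z) : Odd d := by
  rw [Nat.odd_iff]
  by_contra h
  have h2 : 2 ∣ d := Nat.dvd_of_mod_eq_zero (by omega)
  exact ((prime_dvd_oddPrimesProd_iff Nat.prime_two).mp (h2.trans hd)).2 rfl

/-- **The remainder sum of the twin sequence is dominated by the Bombieri–Vinogradov sum**: for
`T ≤ Y`, `∑_{d ∣ P, d < T} |r(d)| ≤ ∑_{d ≤ Y} |π(x; d, −2) − π(x)/φ(d)| + Y`.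
[cite: Nathanson1996, §10.4 (proof of Thm 10.4)] -/
theorem remainderSum_twinSeq_le {x : ℕ} (hx : 2 ≤ x) (z : ℝ) {T Y : ℝ} (hTY : T ≤ Y) (hY : 0 ≤ Y) :
    ∑ d ∈ (oddPrimesProd z).divisors.filter (fun d : ℕ => (d : ℝ) < T),
        |(twinSeq x).remainder d ((x + 2 : ℕ) : ℝ)| ≤
      (∑ d ∈ Finset.Icc 1 ⌊Y⌋₊, |primeCountingDisc d (negTwoUnit d : ZMod d) x|) + Y := by
  have hsub : (oddPrimesProd z).divisors.filter (fun d : ℕ => (d : ℝ) < T) ⊆ Finset.Icc 1 ⌊Y⌋₊ := by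
    intro d hd
    rw [Finset.mem_filter, Nat.mem_divisors] at hd
    rw [Finset.mem_Icc]
    refine ⟨Nat.pos_of_dvd_of_pos hd.1.1 (Nat.pos_of_ne_zero hd.1.2), Nat.le_floor ?_⟩
    linarith [hd.2]
  calc ∑ d ∈ (oddPrimesProd z).divisors.filter (fun d : ℕ => (d : ℝ) < T),
        |(twinSeq x).remainder d ((x + 2 : ℕ) : ℝ)|
      ≤ ∑ d ∈ (oddPrimesProd z).divisors.filter (fun d : ℕ => (d : ℝ) < T),
          (|primeCountingDisc d (negTwoUnit d : ZMod d) x| + 1) := by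
        refine Finset.sum_le_sum fun d hd => ?_
        rw [Finset.mem_filter, Nat.mem_divisors] at hd
        have hodd := odd_of_dvd_oddPrimesProd hd.1.1
        by_cases h1 : d = 1
        · subst h1
          rw [remainder_twinSeq_one hx, abs_zero]
          positivity
        · have hd3 : 3 ≤ d := by
            have hd1 : 1 ≤ d := Nat.pos_of_dvd_of_pos hd.1.1 (Nat.pos_of_ne_zero hd.1.2)
            rcases hodd with ⟨k, rfl⟩
            omega
          exact abs_remainder_twinSeq_le hodd hd3
    _ ≤ ∑ d ∈ Finset.Icc 1 ⌊Y⌋₊, (|primeCountingDisc d (negTwoUnit d : ZMod d) x| + 1) :=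
        Finset.sum_le_sum_of_subset_of_nonneg hsub fun d _ _ => by positivity
    _ = (∑ d ∈ Finset.Icc 1 ⌊Y⌋₊, |primeCountingDisc d (negTwoUnit d : ZMod d) x|) + ⌊Y⌋₊ := by
        rw [Finset.sum_add_distrib, Finset.sum_const, Nat.card_Icc, Nat.add_sub_cancel, nsmul_eq_mul,
          mul_one]
    _ ≤ _ := by gcongr; exact Nat.floor_le hY

/-! ### Hypothesis (9.34) for the twin instance -/

/-- The exceptional set `𝒬 = {p ∣ P : p < u₀}` (the odd primes below `min(u₀, z)`; Nathanson §10.3: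
the primes below `u₀(ε)`). [cite: Nathanson1996, §10.3] -/
def twinExceptional (u₀ z : ℝ) : Finset ℕ :=
  (oddPrimesProd z).primeFactors.filter fun q => (q : ℝ) < u₀

/-- `𝒬 ⊆ {p ∣ P}`. [folklore] -/
theorem twinExceptional_subset (u₀ z : ℝ) : twinExceptional u₀ z ⊆ (oddPrimesProd z).primeFactors :=
  Finset.filter_subset _ _

/-- `Q = ∏_{q ∈ 𝒬} q ≤ ∏_{2 < q < u₀} q`, a bound independent of `z`. [folklore] -/
theorem prod_twinExceptional_le (u₀ z : ℝ) :
    ∏ q ∈ twinExceptional u₀ z, (q : ℝ) ≤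
      ((∏ q ∈ (Nat.primesBelow ⌈u₀⌉₊).filter (fun q => q ≠ 2), q : ℕ) : ℝ) := by
  rw [← Nat.cast_prod, Nat.cast_le]
  refine Finset.prod_le_prod_of_subset_of_one_le' (fun q hq => ?_) (fun q hq _ => ?_)
  · rw [twinExceptional, Finset.mem_filter, primeFactors_oddPrimesProd, mem_filter_primesBelow_ne_two] at hq
    exact mem_filter_primesBelow_ne_two.mpr ⟨hq.1.1, hq.2, hq.1.2.2⟩
  · exact (mem_filter_primesBelow_ne_two.mp hq).1.one_lt.le

/-- `1 ≤ Q`. [folklore] -/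
theorem one_le_prod_twinExceptional (u₀ z : ℝ) : 1 ≤ ∏ q ∈ twinExceptional u₀ z, (q : ℝ) :=
  Finset.one_le_prod fun q hq => by
    rw [twinExceptional, Finset.mem_filter] at hq
    exact_mod_cast (Nat.prime_of_mem_primeFactors hq.1).one_lt.le

/-- The product in (9.34) for the twin sequence is the Mertens product over the primes
`≥ max(u, u₀)` below `z` (for `u₀ ≥ 3`). [folklore] -/
theorem mertensProduct_twinSeq_eq (x : ℕ) {u u₀ z : ℝ} (hu₀ : 3 ≤ u₀) :
    ∏ p ∈ ((oddPrimesProd z).primeFactors \ twinExceptional u₀ z).filter (fun p : ℕ => u ≤ (p : ℝ)),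
        (1 - (twinSeq x).density p)⁻¹ =
      ∏ p ∈ (Nat.primesBelow ⌈z⌉₊).filter (fun p : ℕ => max u u₀ ≤ (p : ℝ)),
        (1 - 1 / ((p : ℝ) - 1))⁻¹ := by
  have hset : ((oddPrimesProd z).primeFactors \ twinExceptional u₀ z).filter (fun p : ℕ => u ≤ (p : ℝ)) =
      (Nat.primesBelow ⌈z⌉₊).filter (fun p : ℕ => max u u₀ ≤ (p : ℝ)) := by
    ext p
    rw [Finset.mem_filter, Finset.mem_sdiff, twinExceptional, Finset.mem_filter,
      primeFactors_oddPrimesProd, mem_filter_primesBelow_ne_two, Finset.mem_filter, Nat.primesBelow,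
      Finset.mem_filter, Finset.mem_range, Nat.lt_ceil, max_le_iff]
    constructor
    · rintro ⟨⟨⟨hp, hpz, hp2⟩, hQ⟩, hup⟩
      refine ⟨⟨hpz, hp⟩, hup, ?_⟩
      by_contra hlt
      exact hQ ⟨⟨hp, hpz, hp2⟩, not_le.mp hlt⟩
    · rintro ⟨⟨hpz, hp⟩, hup, hu₀p⟩
      have hp3 : (3 : ℝ) ≤ p := hu₀.trans hu₀p
      have hp2 : p ≠ 2 := by intro h; subst h; norm_num at hp3
      exact ⟨⟨⟨hp, hpz, hp2⟩, fun h => absurd h.2 (not_lt.mpr hu₀p)⟩, hup⟩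
  rw [hset]
  refine Finset.prod_congr rfl fun p hp => ?_
  rw [Finset.mem_filter, Nat.primesBelow, Finset.mem_filter, max_le_iff] at hp
  have hp3 : (3 : ℝ) ≤ p := hu₀.trans hp.2.2
  have hp2 : p ≠ 2 := by intro h; subst h; norm_num at hp3
  change (1 - shiftedPrimesDensity 2 p)⁻¹ = _
  rw [shiftedPrimesDensity_two_prime hp.1.2 hp2]

/-- **(9.34) for the twin sequence.** For every `ε > 0` there is `u₀ ≥ 3` such that, with
`𝒬 = {p ∣ P : p < u₀}`, hypothesis (9.34) of Theorem 9.7 holds for `g(p) = 1/(p−1)` and EVERY height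
`x` and level `z`: `∏_{p odd, p ≥ u₀, u ≤ p < z} (1 − 1/(p−1))⁻¹ < (1 + ε) log z/log u` for all
`1 < u < z` (Nathanson §10.3, pp. 169–170). [cite: Nathanson1996, §10.3 (verification of (9.34))] -/
theorem hasMertensHypothesis_twinSeq {ε : ℝ} (hε : 0 < ε) :
    ∃ u₀ : ℝ, 3 ≤ u₀ ∧ ∀ (x : ℕ) (z : ℝ),
      (twinSeq x).HasMertensHypothesis (oddPrimesProd z) (twinExceptional u₀ z) ε z := by
  obtain ⟨u₀, hu₀, hM⟩ := exists_prod_one_sub_inv_totient_inv_le (half_pos hε)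
  refine ⟨u₀, hu₀, fun x z => SieveSequence.hasMertensHypothesis_of_le hε fun u hu1 huz => ?_⟩
  rw [mertensProduct_twinSeq_eq x hu₀]
  have hlogu : 0 < Real.log u := Real.log_pos hu1
  have hlogz : Real.log u < Real.log z := Real.log_lt_log (by linarith) huz
  have hratio : 1 < Real.log z / Real.log u := (one_lt_div hlogu).mpr hlogz
  by_cases hmz : max u u₀ < z
  · have h := hM (max u u₀) z (le_max_right _ _) hmz
    have hlogm : Real.log u ≤ Real.log (max u u₀) := Real.log_le_log (by linarith) (le_max_left _ _)
    have h2 : Real.log z / Real.log (max u u₀) ≤ Real.log z / Real.log u :=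
      div_le_div_of_nonneg_left (by linarith) hlogu hlogm
    calc _ ≤ (1 + ε / 2) * (Real.log z / Real.log (max u u₀)) := h
      _ ≤ (1 + ε / 2) * (Real.log z / Real.log u) := by gcongr
  · rw [Finset.filter_false_of_mem, Finset.prod_empty]
    · nlinarith
    · intro p hp
      rw [Nat.primesBelow, Finset.mem_filter, Finset.mem_range, Nat.lt_ceil] at hp
      push Not at hmz ⊢
      exact lt_of_lt_of_le hp.1 hmz

/-- The product in the all-levels form of (9.34) for the twin sequence, window `[u, w)` with
`w ≤ z`: the Mertens product over the primes `≥ max(u, u₀)` below `w` (for `u₀ ≥ 3`). [folklore] -/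
theorem mertensProduct_twinSeq_eq_of_le (x : ℕ) {u u₀ w z : ℝ} (hu₀ : 3 ≤ u₀) (hwz : w ≤ z) :
    ∏ p ∈ ((oddPrimesProd z).primeFactors \ twinExceptional u₀ z).filter
        (fun p : ℕ => u ≤ (p : ℝ) ∧ (p : ℝ) < w), (1 - (twinSeq x).density p)⁻¹ =
      ∏ p ∈ (Nat.primesBelow ⌈w⌉₊).filter (fun p : ℕ => max u u₀ ≤ (p : ℝ)),
        (1 - 1 / ((p : ℝ) - 1))⁻¹ := by
  have hset : ((oddPrimesProd z).primeFactors \ twinExceptional u₀ z).filter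
        (fun p : ℕ => u ≤ (p : ℝ) ∧ (p : ℝ) < w) =
      (Nat.primesBelow ⌈w⌉₊).filter (fun p : ℕ => max u u₀ ≤ (p : ℝ)) := by
    ext p
    rw [Finset.mem_filter, Finset.mem_sdiff, twinExceptional, Finset.mem_filter,
      primeFactors_oddPrimesProd, mem_filter_primesBelow_ne_two, Finset.mem_filter, Nat.primesBelow,
      Finset.mem_filter, Finset.mem_range, Nat.lt_ceil, max_le_iff]
    constructor
    · rintro ⟨⟨⟨hp, hpz, hp2⟩, hQ⟩, hup, hpw⟩
      refine ⟨⟨hpw, hp⟩, hup, ?_⟩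
      by_contra hlt
      exact hQ ⟨⟨hp, hpz, hp2⟩, not_le.mp hlt⟩
    · rintro ⟨⟨hpw, hp⟩, hup, hu₀p⟩
      have hp3 : (3 : ℝ) ≤ p := hu₀.trans hu₀p
      have hp2 : p ≠ 2 := by intro h; subst h; norm_num at hp3
      exact ⟨⟨⟨hp, hpw.trans_le hwz, hp2⟩, fun h => absurd h.2 (not_lt.mpr hu₀p)⟩, hup, hpw⟩
  rw [hset]
  refine Finset.prod_congr rfl fun p hp => ?_
  rw [Finset.mem_filter, Nat.primesBelow, Finset.mem_filter, max_le_iff] at hp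
  have hp3 : (3 : ℝ) ≤ p := hu₀.trans hp.2.2
  have hp2 : p ≠ 2 := by intro h; subst h; norm_num at hp3
  change (1 - shiftedPrimesDensity 2 p)⁻¹ = _
  rw [shiftedPrimesDensity_two_prime hp.1.2 hp2]

/-- **(9.34) for the twin sequence at all sieving levels** (the hypothesis
`SieveSequence.HasMertensHypothesisBelow` of the corrected Jurkat–Richert facts
`LinearSieve.jurkatRichert_lower_allLevels` / `_upper_allLevels`). For every `ε > 0` there is `u₀ ≥ 3`
such that, with `𝒬 = {p ∣ P : p < u₀}`, for `g(p) = 1/(p−1)`, EVERY height `x`, level `z` and all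
`1 < u < w ≤ z`: `∏_{p odd, p ≥ u₀, u ≤ p < w} (1 − 1/(p−1))⁻¹ < (1 + ε) log w/log u` — Nathanson §10.3,
pp. 169–170, where (9.34) is obtained from Thm 6.9 "for any `u₁(ε) ≤ u < z`", uniformly in the level
(here: `exists_prod_one_sub_inv_totient_inv_le`). [cite: Nathanson1996, §10.3 (verification of (9.34))] -/
theorem hasMertensHypothesisBelow_twinSeq {ε : ℝ} (hε : 0 < ε) :
    ∃ u₀ : ℝ, 3 ≤ u₀ ∧ ∀ (x : ℕ) (z : ℝ),
      (twinSeq x).HasMertensHypothesisBelow (oddPrimesProd z) (twinExceptional u₀ z) ε z := by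
  obtain ⟨u₀, hu₀, hM⟩ := exists_prod_one_sub_inv_totient_inv_le (half_pos hε)
  refine ⟨u₀, hu₀, fun x z =>
    SieveSequence.hasMertensHypothesisBelow_of_le hε fun u w hu1 huw hwz => ?_⟩
  rw [mertensProduct_twinSeq_eq_of_le x hu₀ hwz]
  have hlogu : 0 < Real.log u := Real.log_pos hu1
  have hlogw : Real.log u < Real.log w := Real.log_lt_log (by linarith) huw
  have hratio : 1 < Real.log w / Real.log u := (one_lt_div hlogu).mpr hlogw
  by_cases hmw : max u u₀ < w
  · have h := hM (max u u₀) w (le_max_right _ _) hmw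
    have hlogm : Real.log u ≤ Real.log (max u u₀) :=
      Real.log_le_log (by linarith) (le_max_left _ _)
    have h2 : Real.log w / Real.log (max u u₀) ≤ Real.log w / Real.log u :=
      div_le_div_of_nonneg_left (by linarith) hlogu hlogm
    calc _ ≤ (1 + ε / 2) * (Real.log w / Real.log (max u u₀)) := h
      _ ≤ (1 + ε / 2) * (Real.log w / Real.log u) := by gcongr
  · rw [Finset.filter_false_of_mem, Finset.prod_empty]
    · nlinarith
    · intro p hp
      rw [Nat.primesBelow, Finset.mem_filter, Finset.mem_range, Nat.lt_ceil] at hp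
      push Not at hmw ⊢
      exact lt_of_lt_of_le hp.1 hmw

/-! ### Assembly: the estimate (A) -/

/-- `0 ≤ V(w) ≤ 1` for `V(w) = sieveProduct 2 w`. [folklore] -/
theorem sieveProduct_two_mem_Icc (w : ℝ) : 0 ≤ sieveProduct 2 w ∧ sieveProduct 2 w ≤ 1 := by
  rw [sieveProduct_two_eq]
  have hf : ∀ p ∈ (Finset.range ⌈w⌉₊).filter (fun p => p.Prime ∧ 2 < p),
      0 ≤ 1 - 1 / ((p : ℝ) - 1) ∧ 1 - 1 / ((p : ℝ) - 1) ≤ 1 := fun p hp => by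
    have h3 : (3 : ℝ) ≤ p := by exact_mod_cast (Finset.mem_filter.mp hp).2.2
    constructor
    · rw [sub_nonneg, div_le_one (by linarith)]; linarith
    · have : 0 ≤ 1 / ((p : ℝ) - 1) := div_nonneg zero_le_one (by linarith)
      linarith
  exact ⟨Finset.prod_nonneg fun p hp => (hf p hp).1,
    Finset.prod_le_one (fun p hp => (hf p hp).1) fun p hp => (hf p hp).2⟩

/-- `0 ≤ X(x) V(x^{1/8})`. [folklore] -/
theorem twinMainTerm_nonneg (x : ℕ) : 0 ≤ twinMainTerm x := by
  rw [twinMainTerm]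
  refine mul_nonneg ?_ (sieveProduct_two_mem_Icc _).1
  rcases Nat.lt_or_ge x 2 with h | h
  · interval_cases x <;> simp
  · have : (1 : ℝ) < x := by exact_mod_cast h
    exact div_nonneg (by positivity) (Real.log_nonneg this.le)

/-- The lower-bound sieve constant: `f(4 − 8δ) − ε_J e^{14 − (4 − 8δ)} ≥ e^γ log 3/2 − 3ε/16` for
`δ ≤ min(1/16, ε/(16 e^γ))`, `ε_J ≤ ε/(16 e^{11})` (any real `ε_J`; Nathanson p. 172:
`f(s) = e^γ log 3/2 + O(ε)`). [cite: Nathanson1996, §10.4 (proof of Thm 10.4)] -/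
theorem sieveLowerConst_ge {ε δ εJ : ℝ} (hε : 0 < ε) (hδ0 : 0 < δ) (hδ1 : δ ≤ 1 / 16)
    (hδ2 : δ ≤ ε / (16 * Real.exp Real.eulerMascheroniConstant))
    (hεJ : εJ ≤ ε / (16 * Real.exp 11)) :
    Real.exp Real.eulerMascheroniConstant * Real.log 3 / 2 - 3 * ε / 16 ≤
      2 * Real.exp Real.eulerMascheroniConstant * Real.log (4 - 8 * δ - 1) / (4 - 8 * δ) -
        εJ * Real.exp (14 - (4 - 8 * δ)) := by
  set G := Real.exp Real.eulerMascheroniConstant with hG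
  have hG0 : 0 < G := Real.exp_pos _
  have hlog3 : 1 < Real.log 3 := by
    rw [Real.lt_log_iff_exp_lt (by norm_num)]
    exact Real.exp_one_lt_d9.trans (by norm_num)
  -- `log(3 - 8δ) ≥ log 3 - 4δ`
  have hlog : Real.log 3 - 4 * δ ≤ Real.log (4 - 8 * δ - 1) := by
    have ht : 0 < 1 - 8 * δ / 3 := by linarith
    have h1 : Real.log (4 - 8 * δ - 1) = Real.log 3 + Real.log (1 - 8 * δ / 3) := by
      rw [← Real.log_mul (by norm_num) ht.ne']
      congr 1; ring
    have h2 : 1 - (1 - 8 * δ / 3)⁻¹ ≤ Real.log (1 - 8 * δ / 3) := Real.one_sub_inv_le_log_of_pos ht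
    have h3 : (1 - 8 * δ / 3)⁻¹ ≤ 1 + 4 * δ := by
      rw [inv_le_iff_one_le_mul₀ ht]
      nlinarith
    linarith
  -- the main term
  have hmain : G * Real.log 3 / 2 - ε / 8 ≤ 2 * G * Real.log (4 - 8 * δ - 1) / (4 - 8 * δ) := by
    have hden : 0 < 4 - 8 * δ := by linarith
    have hnum : 0 ≤ Real.log 3 - 4 * δ := by linarith
    calc G * Real.log 3 / 2 - ε / 8 ≤ G * Real.log 3 / 2 - 2 * G * δ := by
          have : 2 * G * δ ≤ ε / 8 := by
            rw [le_div_iff₀ (by positivity)] at hδ2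
            linarith
          linarith
      _ = 2 * G * (Real.log 3 - 4 * δ) / 4 := by ring
      _ ≤ 2 * G * (Real.log 3 - 4 * δ) / (4 - 8 * δ) :=
          div_le_div_of_nonneg_left (by positivity) hden (by linarith)
      _ ≤ 2 * G * Real.log (4 - 8 * δ - 1) / (4 - 8 * δ) := by
          gcongr
  -- the error term
  have herr : εJ * Real.exp (14 - (4 - 8 * δ)) ≤ ε / 16 := by
    have h1 : Real.exp (14 - (4 - 8 * δ)) ≤ Real.exp 11 := Real.exp_le_exp.mpr (by linarith)
    calc εJ * Real.exp (14 - (4 - 8 * δ)) ≤ ε / (16 * Real.exp 11) * Real.exp 11 :=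
          mul_le_mul hεJ h1 (Real.exp_pos _).le (by positivity)
      _ = ε / 16 := by field_simp
  linarith

set_option maxHeartbeats 800000 in
/-- **The sieve estimate (A) in the twin form** (`Literature.NumberTheory.Sieve.Chen.twin_sieveLower`,
the analogue of Nathanson's Theorem 10.4 for `𝒜(x) = {p + 2 : 2 < p ≤ x}`), PROVED from the
Jurkat–Richert lower bound in its corrected, all-levels form
(`Literature.NumberTheory.Sieve.LinearSieve.jurkatRichert_lower_allLevels`, Nathanson Thm 9.7/9.8 with
(9.34) at every level `w ≤ z`; itself PROVED in the tree, `jurkatRichert_lower_allLevels_holds`) and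
the Bombieri–Vinogradov theorem (`Literature.NumberTheory.Sieve.BombieriVinogradovStatement`), together
with the prime number theorem and Mertens' theorem proved in the tree (the all-levels hypothesis
(9.34) is `hasMertensHypothesisBelow_twinSeq`). For every `ε > 0` and all large `x`:
`S(𝒜(x), x^{1/8}) ≥ (e^γ log 3/2 − ε)(x/log x) V(x^{1/8})`.
[cite: Nathanson1996, Thm 10.4 (for the sequence {p+2}: ChenSciSinica1973, p. 176)] -/
theorem twin_sieveLower_of_allLevels (hJR : jurkatRichert_lower_allLevels)
    (hBV : BombieriVinogradovStatement) : twin_sieveLower := by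
  intro ε hε
  set G := Real.exp Real.eulerMascheroniConstant with hG
  have hG1 : 1 ≤ G := Real.one_le_exp (by linarith [Real.one_half_lt_eulerMascheroniConstant])
  have hlog3 : 1 < Real.log 3 := by
    rw [Real.lt_log_iff_exp_lt (by norm_num)]
    exact Real.exp_one_lt_d9.trans (by norm_num)
  set a := G * Real.log 3 / 2 with ha
  have ha0 : 0 < a := by positivity
  -- trivial case `ε ≥ a`
  rcases le_or_gt a ε with hεa | hεa
  · refine Eventually.of_forall fun x => ?_
    have h1 : (G * Real.log 3 / 2 - ε) * twinMainTerm x ≤ 0 :=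
      mul_nonpos_of_nonpos_of_nonneg (by linarith) (twinMainTerm_nonneg x)
    exact h1.trans (Nat.cast_nonneg _)
  -- parameters
  set δ := min (1 / 16) (ε / (16 * G)) with hδ
  have hδ0 : 0 < δ := by positivity
  have hδ1 : δ ≤ 1 / 16 := min_le_left _ _
  have hδ2 : δ ≤ ε / (16 * G) := min_le_right _ _
  set εJ := min (1 / 400) (ε / (16 * Real.exp 11)) with hεJ
  have hεJ0 : 0 < εJ := by positivity
  have hεJ1 : εJ < 1 / 200 := lt_of_le_of_lt (min_le_left _ _) (by norm_num)
  have hεJ2 : εJ ≤ ε / (16 * Real.exp 11) := min_le_right _ _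
  set η := ε / (16 * a) with hη
  have hη0 : 0 < η := by positivity
  set θ₁ := 1 / 2 - δ / 2 with hθ₁
  have hθ₁lt : θ₁ < 1 / 2 := by rw [hθ₁]; linarith
  obtain ⟨u₀, hu₀3, hMert⟩ := hasMertensHypothesisBelow_twinSeq hεJ0
  obtain ⟨C, hC⟩ := eventually_sum_abs_primeCountingDisc_le hBV hθ₁lt (A := 4) (by norm_num)
  set c₀ := 16 * Real.exp (-7) with hc₀
  have hc₀0 : 0 < c₀ := by positivity
  -- eventualities
  have hE1 := eventually_primeCounting_bounds hη0
  have hE3 : ∀ᶠ x : ℕ in atTop,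
      ((∏ q ∈ (Nat.primesBelow ⌈u₀⌉₊).filter (fun q => q ≠ 2), q : ℕ) : ℝ) ≤ (x : ℝ) ^ (δ / 2) :=
    ((tendsto_rpow_atTop (by positivity : 0 < δ / 2)).comp tendsto_natCast_atTop_atTop).eventually_ge_atTop _
  have hE4 : ∀ᶠ x : ℕ in atTop, a ≤ ε / 6 * c₀ * x / Real.log x ^ 2 :=
    (tendsto_mul_natCast_div_log_sq_atTop (by positivity : 0 < ε / 6 * c₀)).eventually_ge_atTop a
  have hE5 : ∀ᶠ x : ℕ in atTop, 6 * max C 0 / (ε * c₀) + 1 ≤ Real.log x :=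
    (Real.tendsto_log_atTop.comp tendsto_natCast_atTop_atTop).eventually_ge_atTop _
  have hE6 : ∀ᶠ x : ℕ in atTop, Real.log (x : ℝ) ^ 2 ≤ ε * c₀ / 6 * (x : ℝ) ^ (1 - θ₁) := by
    have hlo := (isLittleO_log_rpow_rpow_atTop 2 (show (0 : ℝ) < 1 - θ₁ by rw [hθ₁]; linarith)).def
      (show 0 < ε * c₀ / 6 by positivity)
    filter_upwards [tendsto_natCast_atTop_atTop.eventually hlo, eventually_ge_atTop 1] with x hx hx1
    have hx0 : (0 : ℝ) ≤ x := Nat.cast_nonneg x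
    rw [Real.norm_of_nonneg (by positivity), Real.norm_of_nonneg (Real.rpow_nonneg hx0 _)] at hx
    have : Real.log (x : ℝ) ^ (2 : ℝ) = Real.log x ^ 2 := by
      rw [show (2 : ℝ) = ((2 : ℕ) : ℝ) by norm_num, Real.rpow_natCast]
    rwa [this] at hx
  filter_upwards [eventually_ge_atTop 6561, hE1, hC, hE3, hE4, hE5, hE6]
    with x hx hPNT hBVx hQx hj1 hj5 hj6
  -- basic facts about `x`
  have hx2 : 2 ≤ x := by omega
  have hx1 : (1 : ℝ) < x := by exact_mod_cast (show 1 < x by omega)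
  have hx0 : (0 : ℝ) < x := by linarith
  have hlog : 0 < Real.log x := Real.log_pos hx1
  have hlog1 : 1 ≤ Real.log x := by
    have : 0 ≤ 6 * max C 0 / (ε * c₀) := by positivity
    linarith
  -- the sieve parameters
  set z := (x : ℝ) ^ (1 / 8 : ℝ) with hz
  set D := (x : ℝ) ^ (1 / 2 - δ) with hD
  have hz2 : 2 ≤ z := by
    rw [hz, show (2 : ℝ) = ((2 : ℝ) ^ (8 : ℕ)) ^ (1 / 8 : ℝ) by
      rw [← Real.rpow_natCast, ← Real.rpow_mul (by norm_num)]; norm_num]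
    exact Real.rpow_le_rpow (by norm_num) (by exact_mod_cast (show 256 ≤ x by omega)) (by norm_num)
  have hlogz : Real.log z = 1 / 8 * Real.log x := by rw [hz, Real.log_rpow hx0]
  have hlogD : Real.log D = (1 / 2 - δ) * Real.log x := by rw [hD, Real.log_rpow hx0]
  have hs : Real.log D / Real.log z = 4 - 8 * δ := by
    rw [hlogz, hlogD]; field_simp; ring
  have hzD : z ^ 2 ≤ D := by
    rw [hz, hD, ← Real.rpow_natCast, ← Real.rpow_mul hx0.le]
    exact Real.rpow_le_rpow_of_exponent_le hx1.le (by norm_num; linarith)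
  have hs4 : Real.log D / Real.log z ≤ 4 := by rw [hs]; linarith
  -- Jurkat–Richert
  have hJ := hJR (twinSeq x) ((x + 2 : ℕ) : ℝ) (oddPrimesProd z) (twinExceptional u₀ z) εJ z D
    (squarefree_oddPrimesProd z) (oddPrimesProd_dvd_primesProdBelow z) (density_twinSeq_mem_Ico x z)
    (twinExceptional_subset u₀ z) hεJ0 hεJ1 hz2 hzD hs4 (twinSeq_size_eq hx2) (hMert x z)
  have hsz : (twinSeq x).size ((x + 2 : ℕ) : ℝ) = (Nat.primeCounting x : ℝ) - 1 := rfl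
  rw [hs, sifted_twinSeq_eq, densityProduct_twinSeq_eq, hsz, ← hG] at hJ
  change _ ≤ (roughCount (twinSieveSet x) (twinZ x) : ℝ) at hJ
  -- names for the quantities
  set V := sieveProduct 2 z with hV
  set P := (Nat.primeCounting x : ℝ) - 1 with hP
  set L := (x : ℝ) / Real.log x with hL
  set R := ∑ d ∈ (oddPrimesProd z).divisors.filter
      (fun d : ℕ => (d : ℝ) < D * ∏ q ∈ twinExceptional u₀ z, (q : ℝ)),
    |(twinSeq x).remainder d ((x + 2 : ℕ) : ℝ)| with hR
  set K := c₀ * x / Real.log x ^ 2 with hK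
  have hVI : 0 ≤ V ∧ V ≤ 1 := sieveProduct_two_mem_Icc z
  have hP0 : 0 ≤ P := by
    have : 1 ≤ Nat.primeCounting x := by
      have := Nat.primesLE_card_eq_primeCounting x
      have h2 : 2 ∈ Nat.primesLE x := Nat.mem_primesLE.mpr ⟨hx2, Nat.prime_two⟩
      have := Finset.card_pos.mpr ⟨2, h2⟩
      omega
    rw [hP]
    have : (1 : ℝ) ≤ Nat.primeCounting x := by exact_mod_cast this
    linarith
  have hL0 : 0 ≤ L := by positivity
  have hmainTerm : twinMainTerm x = L * V := by rw [twinMainTerm, hL, hV, hz]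
  have hKM : K ≤ L * V := by
    rw [← hmainTerm, hK, hc₀]
    exact twinMainTerm_ge hx
  -- (1) the coefficient
  have hcoef := sieveLowerConst_ge hε hδ0 hδ1 hδ2 hεJ2
  rw [← hG, ← ha] at hcoef
  -- (2) the main term: `(a - 3ε/16) V P ≥ (a - ε/4) L V - a`
  have hPNT' : (1 - η) * L - 1 ≤ P := by rw [hP]; linarith [hPNT.1]
  have ha' : 0 ≤ a - 3 * ε / 16 := by linarith
  have hmain : (a - ε / 4) * (L * V) - a ≤ (a - 3 * ε / 16) * (V * P) := by
    have h1 : (a - 3 * ε / 16) * (V * ((1 - η) * L - 1)) ≤ (a - 3 * ε / 16) * (V * P) :=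
      mul_le_mul_of_nonneg_left (mul_le_mul_of_nonneg_left hPNT' hVI.1) ha'
    have h2 : (a - 3 * ε / 16) * V ≤ a := by
      have h21 : (a - 3 * ε / 16) * V ≤ a * V := mul_le_mul_of_nonneg_right (by linarith) hVI.1
      have h22 : a * V ≤ a * 1 := mul_le_mul_of_nonneg_left hVI.2 ha0.le
      linarith
    have h3 : a * η = ε / 16 := by rw [hη]; field_simp
    have h4 : (a - 3 * ε / 16) * η * (L * V) ≤ ε / 16 * (L * V) := by
      refine mul_le_mul_of_nonneg_right ?_ (mul_nonneg hL0 hVI.1)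
      have : (a - 3 * ε / 16) * η = ε / 16 - 3 * ε * η / 16 := by rw [← h3]; ring
      have : 0 ≤ ε * η := mul_nonneg hε.le hη0.le
      linarith
    have hLV : 0 ≤ L * V := mul_nonneg hL0 hVI.1
    linarith
  -- (3) the remainder
  have hDQ : D * (∏ q ∈ twinExceptional u₀ z, (q : ℝ)) ≤ (x : ℝ) ^ θ₁ := by
    calc D * (∏ q ∈ twinExceptional u₀ z, (q : ℝ)) ≤ D * (x : ℝ) ^ (δ / 2) :=
          mul_le_mul_of_nonneg_left ((prod_twinExceptional_le u₀ z).trans hQx) (Real.rpow_nonneg hx0.le _)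
      _ = (x : ℝ) ^ θ₁ := by rw [hD, ← Real.rpow_add hx0, hθ₁]; ring_nf
  have hRle : R ≤ C * x / Real.log x ^ 4 + (x : ℝ) ^ θ₁ := by
    rw [hR]
    refine (remainderSum_twinSeq_le hx2 z hDQ (Real.rpow_nonneg hx0.le θ₁)).trans ?_
    have h2 := hBVx negTwoUnit
    rw [show (4 : ℝ) = ((4 : ℕ) : ℝ) by norm_num, Real.rpow_natCast] at h2
    exact add_le_add h2 le_rfl
  have hj5' : max C 0 * x / Real.log x ^ 4 ≤ ε / 6 * K := by
    have hM0 : 0 ≤ max C 0 := le_max_right _ _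
    have hlog2 : 6 * max C 0 / (ε * c₀) ≤ Real.log x ^ 2 := by
      have h1 : 6 * max C 0 / (ε * c₀) ≤ Real.log x := by linarith
      have h2 : Real.log x ≤ Real.log x ^ 2 := by nlinarith
      exact h1.trans h2
    have hlog3 : 6 * max C 0 ≤ ε * c₀ * Real.log x ^ 2 := by
      rw [div_le_iff₀ (by positivity)] at hlog2
      linarith
    rw [hK, show max C 0 * (x : ℝ) / Real.log x ^ 4 =
        (max C 0 / Real.log x ^ 2) * (x / Real.log x ^ 2) by
          rw [div_mul_div_comm, show Real.log (x : ℝ) ^ 2 * Real.log x ^ 2 = Real.log x ^ 4 by ring],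
      show ε / 6 * (c₀ * x / Real.log x ^ 2) = (ε * c₀ / 6) * (x / Real.log x ^ 2) by ring]
    refine mul_le_mul_of_nonneg_right ?_ (by positivity)
    rw [div_le_iff₀ (by positivity)]
    linarith
  have hj6' : (x : ℝ) ^ θ₁ ≤ ε / 6 * K := by
    have hsplit : (x : ℝ) = (x : ℝ) ^ θ₁ * (x : ℝ) ^ (1 - θ₁) := by
      rw [← Real.rpow_add hx0]; norm_num
    rw [hK, show ε / 6 * (c₀ * x / Real.log x ^ 2) = (ε * c₀ / 6 * x) / Real.log x ^ 2 by ring,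
      le_div_iff₀ (by positivity)]
    calc (x : ℝ) ^ θ₁ * Real.log x ^ 2 ≤ (x : ℝ) ^ θ₁ * (ε * c₀ / 6 * (x : ℝ) ^ (1 - θ₁)) :=
          mul_le_mul_of_nonneg_left hj6 (Real.rpow_nonneg hx0.le _)
      _ = ε * c₀ / 6 * ((x : ℝ) ^ θ₁ * (x : ℝ) ^ (1 - θ₁)) := by ring
      _ = ε * c₀ / 6 * x := by rw [← hsplit]
  have hCle : C * x / Real.log x ^ 4 ≤ max C 0 * x / Real.log x ^ 4 := by
    have : 0 ≤ (x : ℝ) / Real.log x ^ 4 := by positivity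
    rw [mul_div_assoc, mul_div_assoc]
    exact mul_le_mul_of_nonneg_right (le_max_left _ _) this
  have hj1' : a ≤ ε / 6 * K := by
    rw [hK, show ε / 6 * (c₀ * x / Real.log x ^ 2) = ε / 6 * c₀ * x / Real.log x ^ 2 by ring]
    exact hj1
  -- (4) combine
  have hfinal : (a - ε) * (L * V) ≤ (a - 3 * ε / 16) * (V * P) - R := by
    have hεK : ε * K ≤ ε * (L * V) := mul_le_mul_of_nonneg_left hKM hε.le
    have hεLV : 0 ≤ ε * (L * V) := mul_nonneg hε.le (mul_nonneg hL0 hVI.1)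
    have s1 : a + R ≤ ε / 2 * K := by linarith [hRle, hCle, hj5', hj6', hj1']
    have s2 : ε / 2 * K ≤ ε / 2 * (L * V) := by linarith [hεK]
    have s3 : (a - ε) * (L * V) ≤ (a - ε / 4) * (L * V) - ε / 2 * (L * V) := by linarith [hεLV]
    linarith [hmain, s1, s2, s3]
  have hJ' : (a - 3 * ε / 16) * (V * P) - R ≤
      (2 * G * Real.log (4 - 8 * δ - 1) / (4 - 8 * δ) - εJ * Real.exp (14 - (4 - 8 * δ))) * (V * P) - R := by
    have := mul_le_mul_of_nonneg_right hcoef (mul_nonneg hVI.1 hP0)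
    linarith
  rw [hmainTerm]
  linarith [hJ]

/-- **The sieve estimate (A) in the twin form along Nathanson's own route, with the sieve input
PROVED**: `BombieriVinogradovStatement → twin_sieveLower`, from `twin_sieveLower_of_allLevels` and the
tree's proof `LinearSieve.jurkatRichert_lower_allLevels_holds` of Nathanson's Theorem 9.7 (9.36)/9.8
(all-levels form). (The tree also proves `BombieriVinogradovStatement`
(`BombieriVinogradovStatement_holds`, `ParityBarrierLevelProofs.lean`, not imported here) and, by a
different route — Iwaniec's Theorem 1 — the unconditional `Chen.twin_sieveLower_holds`
(`ChenTwinSieveLowerHolds.lean`).)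
[cite: Nathanson1996, Thm 10.4 (for the sequence {p+2}: ChenSciSinica1973, p. 176)] -/
theorem twin_sieveLower_of_bombieriVinogradov (hBV : BombieriVinogradovStatement) : twin_sieveLower :=
  twin_sieveLower_of_allLevels jurkatRichert_lower_allLevels_holds hBV

/-- **Deprecated (2026-08-15) together with its hypothesis**, the single-level Jurkat–Richert fact
`LinearSieve.jurkatRichert_lower` (`JurkatRichertLinearSieve.lean`; mis-stated relative to the
source's proof, which needs (9.34) at every level): use `twin_sieveLower_of_allLevels` /
`twin_sieveLower_of_bombieriVinogradov`, or the unconditional `Chen.twin_sieveLower_holds`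
(`ChenTwinSieveLowerHolds.lean`). *Content (statement unchanged):* (A) in the twin form from the
single-level fact and Bombieri–Vinogradov — now the two-line corollary of
`twin_sieveLower_of_allLevels`, since the single-level fact implies the all-levels one (its
hypothesis is the instance `w = z`, `SieveSequence.HasMertensHypothesisBelow.hasMertensHypothesis`).
[cite: Nathanson1996, Thm 10.4 (for the sequence {p+2}: ChenSciSinica1973, p. 176)] -/
@[deprecated "its hypothesis LinearSieve.jurkatRichert_lower is deprecated (mis-stated): use Literature.NumberTheory.Sieve.Chen.twin_sieveLower_of_allLevels / twin_sieveLower_of_bombieriVinogradov, or the unconditional Chen.twin_sieveLower_holds" (since := "2026-08-15")]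
theorem twin_sieveLower_of (hJR : jurkatRichert_lower) (hBV : BombieriVinogradovStatement) :
    twin_sieveLower :=
  twin_sieveLower_of_allLevels
    (fun A x P Q ε z D hP hPz h01 hQ hε hε' hz hzD hs hX hM =>
      hJR A x P Q ε z D hP hPz h01 hQ hε hε' hz hzD hs hX (hM.hasMertensHypothesis hPz)) hBV

end Literature.NumberTheory.Sieve.Chen
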